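import Literature.Computability.Complexity.KarpChromaticMachine
import Literature.ModelTheory.FiniteModelTheory.LPTemplateTables
import Literature.ModelTheory.FiniteModelTheory.LPTemplateSAT
import HarnessLib

/-!
# `3SAT ≤ₚ CSP(OR_⊥(𝔽₂-equations, 𝔽₃-equations))`: the machine half

Topic `Literature/ModelTheory/FiniteModelTheory`; completes the NP-hardness of
`cspLanguage lpTemplate` (`LPTemplateTables.lean`) for the discharge of
`LichterPago2025_cohomologyFooled`.  `LPTemplateSAT.lean` proves that the gadget structure
`LPRed.gadget L` of the slot literals `L` of a CNF maps to `OR_⊥` iff the CNF is satisfiable; this file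
computes the CODE of the table instance `⟨12r, pullTables (gadget (litFamily w)) (vertexEquiv r)⟩`
(`r` clauses; the elements `Kind × (Fin r × Fin 3)` numbered kind-major by
`KarpChromatic.vertexEquiv`) from a CNF code `w` in polynomial time, in the brick algebra of
`KarpChromaticMachine.lean` (whose slot bricks, genuine arguments `qArg`, slot literals `litOf`,
guard `guard3F` and vertex numbering are reused):

* the five ternary tables (`R¹₀ = R¹₁`: the sort-1 clause tuples; `R²₀ = R²₁ = R²₂`: the sort-2
  clause tuples) are `n³`-bit strings laid out with the FIRST coordinate fastest (Mathlib's
  `finFunctionFinEquiv`, as `encodingRelTables` does), produced by a THREE-level counted fold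
  (`Brick.foldLoop appF`): the innermost level is that of `KarpChromaticMachine` one context deeper,
  and the outer level runs on the first field `⟨w, link bits⟩`, which is long enough (`≥ (12r)²`
  symbols) for its `3(12r)²`-bit pieces to pass the linear clip of `foldLoop_clipF_mem_FP`;
* the binary link table is a two-level fold as in `KarpChromaticMachine`;
* `lpKarpFn_eq_encode`: on EVERY string `w` the map emits the code of the table instance of the
  gadget structure of the slot literals read off `w`;
* **`kSAT_three_karpReducible_cspLanguage : kSAT 3 ≤ₚ cspLanguage lpTemplate`** (guarded by
  canonical code / width `≤ 3` / no empty clause, as `toChromFn`).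

## References

* [LichterPago2025] M. Lichter, B. Pago, arXiv:2407.09097, Lemmas 3.18–3.19 (NP-completeness of the
  intractable OR-construction).
* [AroraBarakCC2009] S. Arora, B. Barak, *Computational Complexity*, CUP 2009, §1.3 (polynomial
  time is closed under composition and bounded loops), Thm. 2.8.
-/

noncomputable section

namespace Literature.ModelTheory.FiniteModelTheory

namespace LPMachine

open _root_.Computability Polynomial
open Literature.Computability.Complexity Literature.Computability.Complexity.Brick
  Literature.Computability.Complexity.HashBricks Literature.Computability.Complexity.Plumb
  Literature.Computability.Complexity.OneInThree Literature.Computability.Complexity.KarpChromatic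
open Literature.Computability.Cryptography (relLanguage RelTables structureOfTables encodingSNPInstance
  encodingRelTables tableBits SNPInstance)
open scoped Notation

/-! ### Arguments of the three levels

The outer fold runs on `x' = ⟨w, pad⟩`; its pieces see `a₁ = ⟨x', 1^{i_e}⟩`, the pieces of the
middle fold see `q₂ = ⟨a₁, 1^{i_b}⟩`, those of the inner fold `q₃ = ⟨q₂, 1^{i_a}⟩`. -/

/-- On `q₃`: the code `w`. [folklore] -/
def wQ3 : List Bool → List Bool := fstF ∘ fstF ∘ fstF ∘ fstF
/-- On `q₃`: the outer index `1^{i_e}`. [folklore] -/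
def ueQ : List Bool → List Bool := sndF ∘ fstF ∘ fstF
/-- On `q₃`: the middle index `1^{i_b}`. [folklore] -/
def ubQ : List Bool → List Bool := sndF ∘ fstF
/-- On `q₃`: the inner index `1^{i_a}`. [folklore] -/
def uaQ : List Bool → List Bool := sndF
/-- On `q₃`: the argument `⟨w, 1^{i_e}⟩` of the slot bricks for the outer element. [folklore] -/
def argE : List Bool → List Bool := fanoutFn wQ3 ueQ
/-- On `q₃`: `⟨w, 1^{i_b}⟩`. [folklore] -/
def argB : List Bool → List Bool := fanoutFn wQ3 ubQ
/-- On `q₃`: `⟨w, 1^{i_a}⟩`. [folklore] -/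
def argA : List Bool → List Bool := fanoutFn wQ3 uaQ

/-- The bit `[i_e = i_b]`. [folklore] -/
def eqEBF : List Bool → List Bool := eqPairFn ∘ fanoutFn ueQ ubQ
/-- The bit `[i_b = i_a]`. [folklore] -/
def eqBAF : List Bool → List Bool := eqPairFn ∘ fanoutFn ubQ uaQ
/-- The polarity bit of the slot `(i_a, t)`. [folklore] -/
def polAF (t : ℕ) : List Bool → List Bool := polF t ∘ argA

/-- The sort-1 membership condition `[x = p_{i_a, t}]` for an element `x` of kind `κ` at slot
position `j` (the clause index being `i_a`): `e⁺_{(i,t)}` for a positive slot, `w⁺_i` for a negative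
one. [cite: LichterPago2025, Lemma 3.18 (proof: the triple of a clause)] -/
def condAF (t : ℕ) (κ : Kind) (j : ℕ) : List Bool → List Bool :=
  match κ with
  | Kind.pos => if j = t then polAF t else fun _ => [false]
  | Kind.v => if j = 0 then notFn (polAF t) else fun _ => [false]
  | _ => fun _ => [false]

/-- The sort-2 membership condition `[x = p'_{i_a, t}]`: `e⁻_{(i,t)}` for a negative slot, `w⁻_i` for a
positive one. [cite: LichterPago2025, Lemma 3.18 (proof)] -/
def condBF (t : ℕ) (κ : Kind) (j : ℕ) : List Bool → List Bool :=
  match κ with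
  | Kind.neg => if j = t then notFn (polAF t) else fun _ => [false]
  | Kind.cl => if j = 0 then polAF t else fun _ => [false]
  | _ => fun _ => [false]

/-- **The bit of the sort-1 clause table** at the tuple `(a, b, e)`, `a = (κ_a, i_a, j_a)` etc.:
`[i_e = i_b = i_a] ∧ [a = p_{i,0}] ∧ [b = p_{i,1}] ∧ [e = p_{i,2}]`. [cite: LichterPago2025, Lemma 3.18 (proof)] -/
def bitAF (κe : Kind) (je : ℕ) (κb : Kind) (jb : ℕ) (κa : Kind) (ja : ℕ) : List Bool → List Bool :=
  andFn (andFn eqEBF eqBAF) (andFn (andFn (condAF 0 κa ja) (condAF 1 κb jb)) (condAF 2 κe je))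

/-- **The bit of the sort-2 clause table.** [cite: LichterPago2025, Lemma 3.18 (proof)] -/
def bitBF (κe : Kind) (je : ℕ) (κb : Kind) (jb : ℕ) (κa : Kind) (ja : ℕ) : List Bool → List Bool :=
  andFn (andFn eqEBF eqBAF) (andFn (andFn (condBF 0 κa ja) (condBF 1 κb jb)) (condBF 2 κe je))

/-- A family of bit bricks indexed by the kinds and slot positions of the three coordinates. [folklore] -/
abbrev BitFamily : Type := Kind → ℕ → Kind → ℕ → Kind → ℕ → (List Bool → List Bool)

/-! ### The three-level fold -/

/-- The three bits `j_a = 0, 1, 2`. [folklore] -/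
def triple3F (bit : BitFamily) (κe : Kind) (je : ℕ) (κb : Kind) (jb : ℕ) (κa : Kind) :
    List Bool → List Bool :=
  fun q => bit κe je κb jb κa 0 q ++ bit κe je κb jb κa 1 q ++ bit κe je κb jb κa 2 q

/-- The number of clauses `⌜r⌝` read off `q₂` (`w = fstF³ q₂`). [folklore] -/
def rQ2 : List Bool → List Bool := lenBinF ∘ fstF ∘ fstF ∘ fstF ∘ fstF
/-- The initial record of the inner fold on `q₂`. [folklore] -/
def innerInit : List Bool → List Bool := fanoutFn id (fanoutFn rQ2 fun _ => boolPair [] [])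
/-- **The inner fold**: the `3r` bits of the elements of kind `κ_a`, on `q₂`. [cite: AroraBarakCC2009, §1.3 (bounded loops)] -/
def inner3F (bit : BitFamily) (κe : Kind) (je : ℕ) (κb : Kind) (jb : ℕ) (κa : Kind) :
    List Bool → List Bool :=
  sndPow 2 ∘ foldLoop appF (clipF 3 (triple3F bit κe je κb jb κa)) X ∘ innerInit
/-- **A line**: `n` bits (the four kinds of `a`), on `q₂`. [folklore] -/
def lineF (bit : BitFamily) (κe : Kind) (je : ℕ) (κb : Kind) (jb : ℕ) : List Bool → List Bool :=
  fun q => inner3F bit κe je κb jb Kind.v q ++ inner3F bit κe je κb jb Kind.pos q ++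
    inner3F bit κe je κb jb Kind.neg q ++ inner3F bit κe je κb jb Kind.cl q
/-- The three lines `j_b = 0, 1, 2`, on `q₂`. [folklore] -/
def midPieceF (bit : BitFamily) (κe : Kind) (je : ℕ) (κb : Kind) : List Bool → List Bool :=
  fun q => lineF bit κe je κb 0 q ++ lineF bit κe je κb 1 q ++ lineF bit κe je κb 2 q
/-- `⌜r⌝` read off `a₁` (`w = fstF² a₁`). [folklore] -/
def rA1 : List Bool → List Bool := lenBinF ∘ fstF ∘ fstF ∘ fstF
/-- The initial record of the middle fold on `a₁`. [folklore] -/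
def midInit : List Bool → List Bool := fanoutFn id (fanoutFn rA1 fun _ => boolPair [] [])
/-- **The middle fold**: the lines of the elements `b` of kind `κ_b`, on `a₁`. [cite: AroraBarakCC2009, §1.3 (bounded loops)] -/
def mid3F (bit : BitFamily) (κe : Kind) (je : ℕ) (κb : Kind) : List Bool → List Bool :=
  sndPow 2 ∘ foldLoop appF (clipF 36 (midPieceF bit κe je κb)) X ∘ midInit
/-- **A plane**: `n²` bits (the four kinds of `b`), on `a₁`. [folklore] -/
def planeF (bit : BitFamily) (κe : Kind) (je : ℕ) : List Bool → List Bool :=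
  fun a => mid3F bit κe je Kind.v a ++ mid3F bit κe je Kind.pos a ++ mid3F bit κe je Kind.neg a ++
    mid3F bit κe je Kind.cl a
/-- The three planes `j_e = 0, 1, 2`, on `a₁`. [folklore] -/
def outerPieceF (bit : BitFamily) (κe : Kind) : List Bool → List Bool :=
  fun a => planeF bit κe 0 a ++ planeF bit κe 1 a ++ planeF bit κe 2 a
/-- `⌜r⌝` read off `x'` (`w = fstF x'`). [folklore] -/
def rX : List Bool → List Bool := lenBinF ∘ fstF ∘ fstF
/-- The initial record of the outer fold on `x'`. [folklore] -/
def outerInit : List Bool → List Bool := fanoutFn id (fanoutFn rX fun _ => boolPair [] [])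
/-- **The outer fold**: the planes of the elements `e` of kind `κ_e`, on `x'` (clip constant `432`:
a piece has `3 n² = 432 r²` bits and `|x'| ≥ r²`). [cite: AroraBarakCC2009, §1.3 (bounded loops)] -/
def outer3F (bit : BitFamily) (κe : Kind) : List Bool → List Bool :=
  sndPow 2 ∘ foldLoop appF (clipF 432 (outerPieceF bit κe)) X ∘ outerInit
/-- **A cube**: `n³` bits (the four kinds of `e`), on `x'`. [folklore] -/
def cubeOnF (bit : BitFamily) : List Bool → List Bool :=
  fun x => outer3F bit Kind.v x ++ outer3F bit Kind.pos x ++ outer3F bit Kind.neg x ++ outer3F bit Kind.cl x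

/-! ### The link table (two levels, on `q = ⟨⟨w, 1ⁱ⟩, 1^{i'}⟩`, row `b`, column `a`) -/

/-- **The link bit** for column `a = (κ, i', j')` (sort 1) and row `b = (κ', i, j)` (sort 2):
`(e⁺_p, e⁻_q)` with the same variable, or `(w⁺_i, w⁻_i)`. On `q` the ROW index is `fstF`'s `1ⁱ`
and the column index is `1^{i'}`, as in `KarpChromaticMachine`. [cite: LichterPago2025, Lemma 3.18 (proof: the pairs in S)] -/
def linkBitF (κ : Kind) (j : ℕ) (κ' : Kind) (j' : ℕ) : List Bool → List Bool :=
  match κ, κ' with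
  | Kind.neg, Kind.pos => sameVarF j j'
  | Kind.cl, Kind.v => if j = 0 ∧ j' = 0 then eqClauseF else fun _ => [false]
  | _, _ => fun _ => [false]

/-- The three link bits `j' = 0, 1, 2`. [folklore] -/
def linkTripleF (κ : Kind) (j : ℕ) (κ' : Kind) : List Bool → List Bool :=
  fun q => linkBitF κ j κ' 0 q ++ linkBitF κ j κ' 1 q ++ linkBitF κ j κ' 2 q
/-- The inner link fold. [cite: AroraBarakCC2009, §1.3 (bounded loops)] -/
def linkInnerF (κ : Kind) (j : ℕ) (κ' : Kind) : List Bool → List Bool :=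
  sndPow 2 ∘ foldLoop appF (clipF 3 (linkTripleF κ j κ')) X ∘ colFoldInit
/-- A link row. [folklore] -/
def linkRowF (κ : Kind) (j : ℕ) : List Bool → List Bool :=
  fun a => linkInnerF κ j Kind.v a ++ linkInnerF κ j Kind.pos a ++ linkInnerF κ j Kind.neg a ++ linkInnerF κ j Kind.cl a
/-- A link group (rows `j = 0, 1, 2`). [folklore] -/
def linkGroupF (κ : Kind) : List Bool → List Bool :=
  fun a => linkRowF κ 0 a ++ linkRowF κ 1 a ++ linkRowF κ 2 a
/-- A link block (rows of kind `κ`). [cite: AroraBarakCC2009, §1.3 (bounded loops)] -/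
def linkBlockF (κ : Kind) : List Bool → List Bool :=
  sndPow 2 ∘ foldLoop appF (clipF Cblk (linkGroupF κ)) X ∘ blockFoldInit
/-- **The link table bits.** [cite: LichterPago2025, Lemma 3.18 (proof)] -/
def linkF : List Bool → List Bool :=
  fun w => linkBlockF Kind.v w ++ linkBlockF Kind.pos w ++ linkBlockF Kind.neg w ++ linkBlockF Kind.cl w

/-! ### The map -/

/-- The long first field `x' = ⟨w, link bits⟩` of the cube folds. [folklore] -/
def padArgF : List Bool → List Bool := fanoutFn id linkF
/-- The sort-1 clause table (`n³` bits). [folklore] -/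
def cubeAF : List Bool → List Bool := cubeOnF bitAF ∘ padArgF
/-- The sort-2 clause table (`n³` bits). [folklore] -/
def cubeBF : List Bool → List Bool := cubeOnF bitBF ∘ padArgF
/-- **All table bits** `R¹₀ R¹₁ R²₀ R²₁ R²₂ S`. [folklore] -/
def tablesF : List Bool → List Bool :=
  fun w => cubeAF w ++ cubeAF w ++ cubeBF w ++ cubeBF w ++ cubeBF w ++ linkF w
/-- **The map on codes**: `w ↦ ⟨⌜12 r⌝, table bits⟩`. [cite: LichterPago2025, Lemmas 3.18–3.19] -/
def lpKarpFn : List Bool → List Bool := fanoutFn vertexNumF tablesF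
/-- **The reduction on strings**: the map on guarded codes (canonical, width `≤ 3`, no empty clause),
the non-code `[1]` otherwise. [cite: LichterPago2025, Lemmas 3.18–3.19] -/
def toLPFn : List Bool → List Bool := iteFn guard3F lpKarpFn fun _ => [true]

/-! ### Membership in `FP` -/

/-- `wQ3 ∈ FP`. [cite: AroraBarakCC2009, §1.3] -/
theorem wQ3_mem_FP : wQ3 ∈ FP :=
  comp_mem_FP fstF_mem_FP (comp_mem_FP fstF_mem_FP (comp_mem_FP fstF_mem_FP fstF_mem_FP))
/-- `ueQ ∈ FP`. [cite: AroraBarakCC2009, §1.3] -/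
theorem ueQ_mem_FP : ueQ ∈ FP := comp_mem_FP sndF_mem_FP (comp_mem_FP fstF_mem_FP fstF_mem_FP)
/-- `ubQ ∈ FP`. [cite: AroraBarakCC2009, §1.3] -/
theorem ubQ_mem_FP : ubQ ∈ FP := comp_mem_FP sndF_mem_FP fstF_mem_FP
/-- `uaQ ∈ FP`. [cite: AroraBarakCC2009, §1.3] -/
theorem uaQ_mem_FP : uaQ ∈ FP := sndF_mem_FP
/-- `argA ∈ FP`. [cite: AroraBarakCC2009, §1.3] -/
theorem argA_mem_FP : argA ∈ FP := fanoutFn_mem_FP wQ3_mem_FP uaQ_mem_FP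
/-- `eqEBF ∈ FP`. [cite: AroraBarakCC2009, §1.3] -/
theorem eqEBF_mem_FP : eqEBF ∈ FP := comp_mem_FP eqPairFn_mem_FP (fanoutFn_mem_FP ueQ_mem_FP ubQ_mem_FP)
/-- `eqBAF ∈ FP`. [cite: AroraBarakCC2009, §1.3] -/
theorem eqBAF_mem_FP : eqBAF ∈ FP := comp_mem_FP eqPairFn_mem_FP (fanoutFn_mem_FP ubQ_mem_FP uaQ_mem_FP)
/-- `polAF t ∈ FP`. [cite: AroraBarakCC2009, §1.3] -/
theorem polAF_mem_FP (t : ℕ) : polAF t ∈ FP := comp_mem_FP (polF_mem_FP t) argA_mem_FP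

/-- `condAF t κ j ∈ FP`. [cite: AroraBarakCC2009, §1.3] -/
theorem condAF_mem_FP (t : ℕ) (κ : Kind) (j : ℕ) : condAF t κ j ∈ FP := by
  cases κ with
  | pos => simp only [condAF]; split_ifs; exacts [polAF_mem_FP t, const_mem_FP _]
  | v => simp only [condAF]; split_ifs; exacts [notFn_mem_FP (polAF_mem_FP t), const_mem_FP _]
  | neg => simp only [condAF]; exact const_mem_FP _
  | cl => simp only [condAF]; exact const_mem_FP _

/-- `condBF t κ j ∈ FP`. [cite: AroraBarakCC2009, §1.3] -/
theorem condBF_mem_FP (t : ℕ) (κ : Kind) (j : ℕ) : condBF t κ j ∈ FP := by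
  cases κ with
  | neg => simp only [condBF]; split_ifs; exacts [notFn_mem_FP (polAF_mem_FP t), const_mem_FP _]
  | cl => simp only [condBF]; split_ifs; exacts [polAF_mem_FP t, const_mem_FP _]
  | v => simp only [condBF]; exact const_mem_FP _
  | pos => simp only [condBF]; exact const_mem_FP _

/-- **Every sort-1 table bit is in `FP`.** [cite: AroraBarakCC2009, §1.3] -/
theorem bitAF_mem_FP (κe : Kind) (je : ℕ) (κb : Kind) (jb : ℕ) (κa : Kind) (ja : ℕ) :
    bitAF κe je κb jb κa ja ∈ FP :=
  andFn_mem_FP (andFn_mem_FP eqEBF_mem_FP eqBAF_mem_FP) (andFn_mem_FP (andFn_mem_FP (condAF_mem_FP 0 κa ja)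
    (condAF_mem_FP 1 κb jb)) (condAF_mem_FP 2 κe je))

/-- **Every sort-2 table bit is in `FP`.** [cite: AroraBarakCC2009, §1.3] -/
theorem bitBF_mem_FP (κe : Kind) (je : ℕ) (κb : Kind) (jb : ℕ) (κa : Kind) (ja : ℕ) :
    bitBF κe je κb jb κa ja ∈ FP :=
  andFn_mem_FP (andFn_mem_FP eqEBF_mem_FP eqBAF_mem_FP) (andFn_mem_FP (andFn_mem_FP (condBF_mem_FP 0 κa ja)
    (condBF_mem_FP 1 κb jb)) (condBF_mem_FP 2 κe je))

section FP

variable {bit : BitFamily} (hbit : ∀ κe je κb jb κa ja, bit κe je κb jb κa ja ∈ FP)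
include hbit

/-- `triple3F bit … ∈ FP`. [cite: AroraBarakCC2009, §1.3] -/
theorem triple3F_mem_FP (κe : Kind) (je : ℕ) (κb : Kind) (jb : ℕ) (κa : Kind) :
    triple3F bit κe je κb jb κa ∈ FP :=
  append_mem_FP (append_mem_FP (hbit κe je κb jb κa 0) (hbit κe je κb jb κa 1)) (hbit κe je κb jb κa 2)

omit hbit in
/-- `rQ2 ∈ FP`. [cite: AroraBarakCC2009, §1.3] -/
theorem rQ2_mem_FP : rQ2 ∈ FP :=
  comp_mem_FP lenBinF_mem_FP (comp_mem_FP fstF_mem_FP (comp_mem_FP fstF_mem_FP (comp_mem_FP fstF_mem_FP fstF_mem_FP)))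

omit hbit in
/-- `innerInit ∈ FP`. [cite: AroraBarakCC2009, §1.3] -/
theorem innerInit_mem_FP : innerInit ∈ FP :=
  fanoutFn_mem_FP OracleCompose.id_mem_FP (fanoutFn_mem_FP rQ2_mem_FP (const_mem_FP _))

/-- **`inner3F bit … ∈ FP`** (`foldLoop_clipF_mem_FP`). [cite: AroraBarakCC2009, §1.3 (bounded loops)] -/
theorem inner3F_mem_FP (κe : Kind) (je : ℕ) (κb : Kind) (jb : ℕ) (κa : Kind) :
    inner3F bit κe je κb jb κa ∈ FP :=
  comp_mem_FP (sndPow_mem_FP 2) (comp_mem_FP (foldLoop_clipF_mem_FP 3 appF_mem_FP length_appF_le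
    (triple3F_mem_FP hbit κe je κb jb κa) _) innerInit_mem_FP)

/-- `lineF bit … ∈ FP`. [cite: AroraBarakCC2009, §1.3] -/
theorem lineF_mem_FP (κe : Kind) (je : ℕ) (κb : Kind) (jb : ℕ) : lineF bit κe je κb jb ∈ FP :=
  append_mem_FP (append_mem_FP (append_mem_FP (inner3F_mem_FP hbit κe je κb jb _)
    (inner3F_mem_FP hbit κe je κb jb _)) (inner3F_mem_FP hbit κe je κb jb _)) (inner3F_mem_FP hbit κe je κb jb _)

/-- `midPieceF bit … ∈ FP`. [cite: AroraBarakCC2009, §1.3] -/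
theorem midPieceF_mem_FP (κe : Kind) (je : ℕ) (κb : Kind) : midPieceF bit κe je κb ∈ FP :=
  append_mem_FP (append_mem_FP (lineF_mem_FP hbit κe je κb 0) (lineF_mem_FP hbit κe je κb 1))
    (lineF_mem_FP hbit κe je κb 2)

omit hbit in
/-- `rA1 ∈ FP`. [cite: AroraBarakCC2009, §1.3] -/
theorem rA1_mem_FP : rA1 ∈ FP :=
  comp_mem_FP lenBinF_mem_FP (comp_mem_FP fstF_mem_FP (comp_mem_FP fstF_mem_FP fstF_mem_FP))

omit hbit in
/-- `midInit ∈ FP`. [cite: AroraBarakCC2009, §1.3] -/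
theorem midInit_mem_FP : midInit ∈ FP :=
  fanoutFn_mem_FP OracleCompose.id_mem_FP (fanoutFn_mem_FP rA1_mem_FP (const_mem_FP _))

/-- **`mid3F bit … ∈ FP`** (`foldLoop_clipF_mem_FP`). [cite: AroraBarakCC2009, §1.3 (bounded loops)] -/
theorem mid3F_mem_FP (κe : Kind) (je : ℕ) (κb : Kind) : mid3F bit κe je κb ∈ FP :=
  comp_mem_FP (sndPow_mem_FP 2) (comp_mem_FP (foldLoop_clipF_mem_FP 36 appF_mem_FP length_appF_le
    (midPieceF_mem_FP hbit κe je κb) _) midInit_mem_FP)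

/-- `planeF bit … ∈ FP`. [cite: AroraBarakCC2009, §1.3] -/
theorem planeF_mem_FP (κe : Kind) (je : ℕ) : planeF bit κe je ∈ FP :=
  append_mem_FP (append_mem_FP (append_mem_FP (mid3F_mem_FP hbit κe je _) (mid3F_mem_FP hbit κe je _))
    (mid3F_mem_FP hbit κe je _)) (mid3F_mem_FP hbit κe je _)

/-- `outerPieceF bit … ∈ FP`. [cite: AroraBarakCC2009, §1.3] -/
theorem outerPieceF_mem_FP (κe : Kind) : outerPieceF bit κe ∈ FP :=
  append_mem_FP (append_mem_FP (planeF_mem_FP hbit κe 0) (planeF_mem_FP hbit κe 1)) (planeF_mem_FP hbit κe 2)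

omit hbit in
/-- `rX ∈ FP`. [cite: AroraBarakCC2009, §1.3] -/
theorem rX_mem_FP : rX ∈ FP := comp_mem_FP lenBinF_mem_FP (comp_mem_FP fstF_mem_FP fstF_mem_FP)

omit hbit in
/-- `outerInit ∈ FP`. [cite: AroraBarakCC2009, §1.3] -/
theorem outerInit_mem_FP : outerInit ∈ FP :=
  fanoutFn_mem_FP OracleCompose.id_mem_FP (fanoutFn_mem_FP rX_mem_FP (const_mem_FP _))

/-- **`outer3F bit … ∈ FP`** (`foldLoop_clipF_mem_FP`). [cite: AroraBarakCC2009, §1.3 (bounded loops)] -/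
theorem outer3F_mem_FP (κe : Kind) : outer3F bit κe ∈ FP :=
  comp_mem_FP (sndPow_mem_FP 2) (comp_mem_FP (foldLoop_clipF_mem_FP 432 appF_mem_FP length_appF_le
    (outerPieceF_mem_FP hbit κe) _) outerInit_mem_FP)

/-- **`cubeOnF bit ∈ FP`.** [cite: AroraBarakCC2009, §1.3] -/
theorem cubeOnF_mem_FP : cubeOnF bit ∈ FP :=
  append_mem_FP (append_mem_FP (append_mem_FP (outer3F_mem_FP hbit _) (outer3F_mem_FP hbit _))
    (outer3F_mem_FP hbit _)) (outer3F_mem_FP hbit _)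

end FP

/-- **Every link bit is in `FP`.** [cite: AroraBarakCC2009, §1.3] -/
theorem linkBitF_mem_FP (κ : Kind) (j : ℕ) (κ' : Kind) (j' : ℕ) : linkBitF κ j κ' j' ∈ FP := by
  cases κ <;> cases κ' <;> simp only [linkBitF]
  case neg.pos => exact sameVarF_mem_FP j j'
  case cl.v => split_ifs; exacts [eqClauseF_mem_FP, const_mem_FP _]
  all_goals exact const_mem_FP _

/-- `linkTripleF κ j κ' ∈ FP`. [cite: AroraBarakCC2009, §1.3] -/
theorem linkTripleF_mem_FP (κ : Kind) (j : ℕ) (κ' : Kind) : linkTripleF κ j κ' ∈ FP :=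
  append_mem_FP (append_mem_FP (linkBitF_mem_FP κ j κ' 0) (linkBitF_mem_FP κ j κ' 1)) (linkBitF_mem_FP κ j κ' 2)
/-- `linkInnerF κ j κ' ∈ FP` (`foldLoop_clipF_mem_FP`). [cite: AroraBarakCC2009, §1.3 (bounded loops)] -/
theorem linkInnerF_mem_FP (κ : Kind) (j : ℕ) (κ' : Kind) : linkInnerF κ j κ' ∈ FP :=
  comp_mem_FP (sndPow_mem_FP 2) (comp_mem_FP
    (foldLoop_clipF_mem_FP 3 appF_mem_FP length_appF_le (linkTripleF_mem_FP κ j κ') _) colFoldInit_mem_FP)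
/-- `linkRowF κ j ∈ FP`. [cite: AroraBarakCC2009, §1.3] -/
theorem linkRowF_mem_FP (κ : Kind) (j : ℕ) : linkRowF κ j ∈ FP :=
  append_mem_FP (append_mem_FP (append_mem_FP (linkInnerF_mem_FP κ j _) (linkInnerF_mem_FP κ j _))
    (linkInnerF_mem_FP κ j _)) (linkInnerF_mem_FP κ j _)
/-- `linkGroupF κ ∈ FP`. [cite: AroraBarakCC2009, §1.3] -/
theorem linkGroupF_mem_FP (κ : Kind) : linkGroupF κ ∈ FP :=
  append_mem_FP (append_mem_FP (linkRowF_mem_FP κ 0) (linkRowF_mem_FP κ 1)) (linkRowF_mem_FP κ 2)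
/-- `linkBlockF κ ∈ FP` (`foldLoop_clipF_mem_FP`). [cite: AroraBarakCC2009, §1.3 (bounded loops)] -/
theorem linkBlockF_mem_FP (κ : Kind) : linkBlockF κ ∈ FP :=
  comp_mem_FP (sndPow_mem_FP 2) (comp_mem_FP
    (foldLoop_clipF_mem_FP Cblk appF_mem_FP length_appF_le (linkGroupF_mem_FP κ) _) blockFoldInit_mem_FP)
/-- **`linkF ∈ FP`.** [cite: AroraBarakCC2009, §1.3] -/
theorem linkF_mem_FP : linkF ∈ FP :=
  append_mem_FP (append_mem_FP (append_mem_FP (linkBlockF_mem_FP _) (linkBlockF_mem_FP _)) (linkBlockF_mem_FP _))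
    (linkBlockF_mem_FP _)
/-- `padArgF ∈ FP`. [cite: AroraBarakCC2009, §1.3] -/
theorem padArgF_mem_FP : padArgF ∈ FP := fanoutFn_mem_FP OracleCompose.id_mem_FP linkF_mem_FP
/-- **`cubeAF ∈ FP`.** [cite: AroraBarakCC2009, §1.3] -/
theorem cubeAF_mem_FP : cubeAF ∈ FP := comp_mem_FP (cubeOnF_mem_FP bitAF_mem_FP) padArgF_mem_FP
/-- **`cubeBF ∈ FP`.** [cite: AroraBarakCC2009, §1.3] -/
theorem cubeBF_mem_FP : cubeBF ∈ FP := comp_mem_FP (cubeOnF_mem_FP bitBF_mem_FP) padArgF_mem_FP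
/-- **`tablesF ∈ FP`.** [cite: AroraBarakCC2009, §1.3] -/
theorem tablesF_mem_FP : tablesF ∈ FP :=
  append_mem_FP (append_mem_FP (append_mem_FP (append_mem_FP (append_mem_FP cubeAF_mem_FP cubeAF_mem_FP)
    cubeBF_mem_FP) cubeBF_mem_FP) cubeBF_mem_FP) linkF_mem_FP
/-- **`lpKarpFn ∈ FP`.** [cite: AroraBarakCC2009, Thm. 2.8] -/
theorem lpKarpFn_mem_FP : lpKarpFn ∈ FP := fanoutFn_mem_FP vertexNumF_mem_FP tablesF_mem_FP
/-- **`toLPFn ∈ FP`.** [cite: AroraBarakCC2009, Thm. 2.8] -/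
theorem toLPFn_mem_FP : toLPFn ∈ FP := iteFn_mem_FP guard3F_mem_FP lpKarpFn_mem_FP (const_mem_FP _)

/-! ### Genuine arguments and the values of the bit bricks -/

/-- The long first field `x' = ⟨w, pad⟩`. [folklore] -/
def xArg (w pad : List Bool) : List Bool := boolPair w pad
/-- `a₁ = ⟨x', 1^{i_e}⟩`. [folklore] -/
def a1Arg (w pad : List Bool) (ie : ℕ) : List Bool := boolPair (xArg w pad) (ones ie)
/-- `q₂ = ⟨a₁, 1^{i_b}⟩`. [folklore] -/
def q2Arg (w pad : List Bool) (ie ib : ℕ) : List Bool := boolPair (a1Arg w pad ie) (ones ib)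
/-- `q₃ = ⟨q₂, 1^{i_a}⟩`. [folklore] -/
def q3Arg (w pad : List Bool) (ie ib ia : ℕ) : List Bool := boolPair (q2Arg w pad ie ib) (ones ia)

/-- `wQ3 q₃ = w`. [folklore] -/
@[simp] theorem wQ3_q3Arg (w pad : List Bool) (ie ib ia : ℕ) : wQ3 (q3Arg w pad ie ib ia) = w := by
  simp [wQ3, q3Arg, q2Arg, a1Arg, xArg]
/-- `ueQ q₃ = 1^{i_e}`. [folklore] -/
@[simp] theorem ueQ_q3Arg (w pad : List Bool) (ie ib ia : ℕ) : ueQ (q3Arg w pad ie ib ia) = ones ie := by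
  simp [ueQ, q3Arg, q2Arg, a1Arg]
/-- `ubQ q₃ = 1^{i_b}`. [folklore] -/
@[simp] theorem ubQ_q3Arg (w pad : List Bool) (ie ib ia : ℕ) : ubQ (q3Arg w pad ie ib ia) = ones ib := by
  simp [ubQ, q3Arg, q2Arg]
/-- `uaQ q₃ = 1^{i_a}`. [folklore] -/
@[simp] theorem uaQ_q3Arg (w pad : List Bool) (ie ib ia : ℕ) : uaQ (q3Arg w pad ie ib ia) = ones ia := by
  simp [uaQ, q3Arg]
/-- `argA q₃ = ⟨w, 1^{i_a}⟩`. [folklore] -/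
@[simp] theorem argA_q3Arg (w pad : List Bool) (ie ib ia : ℕ) : argA (q3Arg w pad ie ib ia) = boolPair w (ones ia) := by
  simp [argA]
/-- `argB q₃ = ⟨w, 1^{i_b}⟩`. [folklore] -/
@[simp] theorem argB_q3Arg (w pad : List Bool) (ie ib ia : ℕ) : argB (q3Arg w pad ie ib ia) = boolPair w (ones ib) := by
  simp [argB]
/-- `argE q₃ = ⟨w, 1^{i_e}⟩`. [folklore] -/
@[simp] theorem argE_q3Arg (w pad : List Bool) (ie ib ia : ℕ) : argE (q3Arg w pad ie ib ia) = boolPair w (ones ie) := by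
  simp [argE]

/-- `eqEBF q₃ = [i_e = i_b]`. [folklore] -/
theorem eqEBF_q3Arg (w pad : List Bool) (ie ib ia : ℕ) : eqEBF (q3Arg w pad ie ib ia) = [decide (ie = ib)] := by
  simp only [eqEBF, Function.comp_apply, fanoutFn_apply, ueQ_q3Arg, ubQ_q3Arg, eqPairFn_boolPair, ones,
    List.replicate_left_inj]
/-- `eqBAF q₃ = [i_b = i_a]`. [folklore] -/
theorem eqBAF_q3Arg (w pad : List Bool) (ie ib ia : ℕ) : eqBAF (q3Arg w pad ie ib ia) = [decide (ib = ia)] := by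
  simp only [eqBAF, Function.comp_apply, fanoutFn_apply, ubQ_q3Arg, uaQ_q3Arg, eqPairFn_boolPair, ones,
    List.replicate_left_inj]
/-- `polAF t q₃ = [polarity of (i_a, t)]`. [folklore] -/
theorem polAF_q3Arg (t : ℕ) (w pad : List Bool) (ie ib ia : ℕ) :
    polAF t (q3Arg w pad ie ib ia) = [(litOf w ia t).2] := by
  rw [polAF, Function.comp_apply, argA_q3Arg, polF_boolPair]; rfl

/-- A family of bit VALUES `bv w κe je κb jb κa ja ie ib ia`. [folklore] -/
abbrev BitVal : Type := List Bool → Kind → ℕ → Kind → ℕ → Kind → ℕ → ℕ → ℕ → ℕ → Bool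

/-- Value of the sort-1 membership condition. [folklore] -/
def condAVal (w : List Bool) (t : ℕ) (κ : Kind) (j : ℕ) (i : ℕ) : Bool :=
  match κ with
  | Kind.pos => decide (j = t) && (litOf w i t).2
  | Kind.v => decide (j = 0) && !(litOf w i t).2
  | _ => false

/-- Value of the sort-2 membership condition. [folklore] -/
def condBVal (w : List Bool) (t : ℕ) (κ : Kind) (j : ℕ) (i : ℕ) : Bool :=
  match κ with
  | Kind.neg => decide (j = t) && !(litOf w i t).2
  | Kind.cl => decide (j = 0) && (litOf w i t).2
  | _ => false

/-- `condAF` on a genuine argument. [folklore] -/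
theorem condAF_q3Arg (t : ℕ) (κ : Kind) (j : ℕ) (w pad : List Bool) (ie ib ia : ℕ) :
    condAF t κ j (q3Arg w pad ie ib ia) = [condAVal w t κ j ia] := by
  cases κ with
  | pos =>
    simp only [condAF, condAVal]
    split_ifs with h
    · rw [polAF_q3Arg, h]; simp
    · simp [h]
  | v =>
    simp only [condAF, condAVal]
    split_ifs with h
    · rw [notFn_apply (polAF_q3Arg t w pad ie ib ia), h]; simp
    · simp [h]
  | neg => rfl
  | cl => rfl

/-- `condBF` on a genuine argument. [folklore] -/
theorem condBF_q3Arg (t : ℕ) (κ : Kind) (j : ℕ) (w pad : List Bool) (ie ib ia : ℕ) :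
    condBF t κ j (q3Arg w pad ie ib ia) = [condBVal w t κ j ia] := by
  cases κ with
  | neg =>
    simp only [condBF, condBVal]
    split_ifs with h
    · rw [notFn_apply (polAF_q3Arg t w pad ie ib ia), h]; simp
    · simp [h]
  | cl =>
    simp only [condBF, condBVal]
    split_ifs with h
    · rw [polAF_q3Arg, h]; simp
    · simp [h]
  | v => rfl
  | pos => rfl

/-- **Value of the sort-1 table bit.** [folklore] -/
def bitAVal : BitVal := fun w κe je κb jb κa ja ie ib ia =>
  (decide (ie = ib) && decide (ib = ia)) && ((condAVal w 0 κa ja ia && condAVal w 1 κb jb ia) && condAVal w 2 κe je ia)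

/-- **Value of the sort-2 table bit.** [folklore] -/
def bitBVal : BitVal := fun w κe je κb jb κa ja ie ib ia =>
  (decide (ie = ib) && decide (ib = ia)) && ((condBVal w 0 κa ja ia && condBVal w 1 κb jb ia) && condBVal w 2 κe je ia)

/-- `bitAF` on a genuine argument. [folklore] -/
theorem bitAF_q3Arg (w pad : List Bool) (κe : Kind) (je : ℕ) (κb : Kind) (jb : ℕ) (κa : Kind) (ja : ℕ)
    (ie ib ia : ℕ) : bitAF κe je κb jb κa ja (q3Arg w pad ie ib ia) = [bitAVal w κe je κb jb κa ja ie ib ia] :=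
  andFn_apply (andFn_apply (eqEBF_q3Arg w pad ie ib ia) (eqBAF_q3Arg w pad ie ib ia))
    (andFn_apply (andFn_apply (condAF_q3Arg 0 κa ja w pad ie ib ia) (condAF_q3Arg 1 κb jb w pad ie ib ia))
      (condAF_q3Arg 2 κe je w pad ie ib ia))

/-- `bitBF` on a genuine argument. [folklore] -/
theorem bitBF_q3Arg (w pad : List Bool) (κe : Kind) (je : ℕ) (κb : Kind) (jb : ℕ) (κa : Kind) (ja : ℕ)
    (ie ib ia : ℕ) : bitBF κe je κb jb κa ja (q3Arg w pad ie ib ia) = [bitBVal w κe je κb jb κa ja ie ib ia] :=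
  andFn_apply (andFn_apply (eqEBF_q3Arg w pad ie ib ia) (eqBAF_q3Arg w pad ie ib ia))
    (andFn_apply (andFn_apply (condBF_q3Arg 0 κa ja w pad ie ib ia) (condBF_q3Arg 1 κb jb w pad ie ib ia))
      (condBF_q3Arg 2 κe je w pad ie ib ia))

/-! ### Values of the three-level fold -/

section Values

variable (bit : BitFamily) (bv : BitVal)
  (hbv : ∀ w pad κe je κb jb κa ja ie ib ia, bit κe je κb jb κa ja (q3Arg w pad ie ib ia) = [bv w κe je κb jb κa ja ie ib ia])

/-- The three bits of the inner piece, as values. [folklore] -/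
def tripleBits (w : List Bool) (κe : Kind) (je : ℕ) (κb : Kind) (jb : ℕ) (κa : Kind) (ie ib ia : ℕ) : List Bool :=
  [bv w κe je κb jb κa 0 ie ib ia, bv w κe je κb jb κa 1 ie ib ia, bv w κe je κb jb κa 2 ie ib ia]
/-- The bits of the elements `a` of kind `κ_a` (inner fold). [folklore] -/
def innerBits (w : List Bool) (κe : Kind) (je : ℕ) (κb : Kind) (jb : ℕ) (κa : Kind) (ie ib : ℕ) : List Bool :=
  ccat (tripleBits bv w κe je κb jb κa ie ib) (rOf w)
/-- A line: all elements `a`. [folklore] -/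
def lineBits (w : List Bool) (κe : Kind) (je : ℕ) (κb : Kind) (jb : ℕ) (ie ib : ℕ) : List Bool :=
  innerBits bv w κe je κb jb Kind.v ie ib ++ innerBits bv w κe je κb jb Kind.pos ie ib ++
    innerBits bv w κe je κb jb Kind.neg ie ib ++ innerBits bv w κe je κb jb Kind.cl ie ib
/-- The three lines of the middle piece. [folklore] -/
def midPieceBits (w : List Bool) (κe : Kind) (je : ℕ) (κb : Kind) (ie ib : ℕ) : List Bool :=
  lineBits bv w κe je κb 0 ie ib ++ lineBits bv w κe je κb 1 ie ib ++ lineBits bv w κe je κb 2 ie ib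
/-- The lines of the elements `b` of kind `κ_b` (middle fold). [folklore] -/
def midBits (w : List Bool) (κe : Kind) (je : ℕ) (κb : Kind) (ie : ℕ) : List Bool :=
  ccat (midPieceBits bv w κe je κb ie) (rOf w)
/-- A plane: all elements `b`. [folklore] -/
def planeBits (w : List Bool) (κe : Kind) (je : ℕ) (ie : ℕ) : List Bool :=
  midBits bv w κe je Kind.v ie ++ midBits bv w κe je Kind.pos ie ++ midBits bv w κe je Kind.neg ie ++
    midBits bv w κe je Kind.cl ie
/-- The three planes of the outer piece. [folklore] -/
def outerPieceBits (w : List Bool) (κe : Kind) (ie : ℕ) : List Bool :=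
  planeBits bv w κe 0 ie ++ planeBits bv w κe 1 ie ++ planeBits bv w κe 2 ie
/-- The planes of the elements `e` of kind `κ_e` (outer fold). [folklore] -/
def outerBits (w : List Bool) (κe : Kind) : List Bool := ccat (outerPieceBits bv w κe) (rOf w)
/-- **The cube read off `w`.** [folklore] -/
def cubeBits (w : List Bool) : List Bool :=
  outerBits bv w Kind.v ++ outerBits bv w Kind.pos ++ outerBits bv w Kind.neg ++ outerBits bv w Kind.cl

/-- `|innerBits| = 3r`. [folklore] -/
theorem length_innerBits (w : List Bool) (κe : Kind) (je : ℕ) (κb : Kind) (jb : ℕ) (κa : Kind) (ie ib : ℕ) :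
    (innerBits bv w κe je κb jb κa ie ib).length = rOf w * 3 :=
  length_ccat_const (b := 3) (fun _ => rfl) _
/-- `|lineBits| = n`. [folklore] -/
theorem length_lineBits (w : List Bool) (κe : Kind) (je : ℕ) (κb : Kind) (jb : ℕ) (ie ib : ℕ) :
    (lineBits bv w κe je κb jb ie ib).length = 4 * (rOf w * 3) := by
  simp only [lineBits, List.length_append, length_innerBits]; ring
/-- `|midPieceBits| = 3n`. [folklore] -/
theorem length_midPieceBits (w : List Bool) (κe : Kind) (je : ℕ) (κb : Kind) (ie ib : ℕ) :
    (midPieceBits bv w κe je κb ie ib).length = 3 * (4 * (rOf w * 3)) := by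
  simp only [midPieceBits, List.length_append, length_lineBits]; ring
/-- `|midBits| = r · 3n`. [folklore] -/
theorem length_midBits (w : List Bool) (κe : Kind) (je : ℕ) (κb : Kind) (ie : ℕ) :
    (midBits bv w κe je κb ie).length = rOf w * (3 * (4 * (rOf w * 3))) :=
  length_ccat_const (length_midPieceBits bv w κe je κb ie) _
/-- `|planeBits| = n²`. [folklore] -/
theorem length_planeBits (w : List Bool) (κe : Kind) (je : ℕ) (ie : ℕ) :
    (planeBits bv w κe je ie).length = (4 * (rOf w * 3)) * (4 * (rOf w * 3)) := by
  simp only [planeBits, List.length_append, length_midBits]; ring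
/-- `|outerPieceBits| = 3n²`. [folklore] -/
theorem length_outerPieceBits (w : List Bool) (κe : Kind) (ie : ℕ) :
    (outerPieceBits bv w κe ie).length = 3 * ((4 * (rOf w * 3)) * (4 * (rOf w * 3))) := by
  simp only [outerPieceBits, List.length_append, length_planeBits]; ring
/-- `|outerBits| = r · 3n²`. [folklore] -/
theorem length_outerBits (w : List Bool) (κe : Kind) :
    (outerBits bv w κe).length = rOf w * (3 * ((4 * (rOf w * 3)) * (4 * (rOf w * 3)))) :=
  length_ccat_const (length_outerPieceBits bv w κe) _
/-- `|cubeBits| = n³`. [folklore] -/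
theorem length_cubeBits (w : List Bool) :
    (cubeBits bv w).length = (4 * (rOf w * 3)) * ((4 * (rOf w * 3)) * (4 * (rOf w * 3))) := by
  simp only [cubeBits, List.length_append, length_outerBits]; ring

include hbv

/-- Value of the inner piece. [folklore] -/
theorem triple3F_q3Arg (w pad : List Bool) (κe : Kind) (je : ℕ) (κb : Kind) (jb : ℕ) (κa : Kind) (ie ib ia : ℕ) :
    triple3F bit κe je κb jb κa (q3Arg w pad ie ib ia) = tripleBits bv w κe je κb jb κa ie ib ia := by
  simp [triple3F, hbv, tripleBits]

/-- **Value of the inner fold** on `q₂`. [folklore] -/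
theorem inner3F_q2Arg (w pad : List Bool) (κe : Kind) (je : ℕ) (κb : Kind) (jb : ℕ) (κa : Kind) (ie ib : ℕ) :
    inner3F bit κe je κb jb κa (q2Arg w pad ie ib) = innerBits bv w κe je κb jb κa ie ib := by
  have hinit : innerInit (q2Arg w pad ie ib) =
      boolPair (q2Arg w pad ie ib) (boolPair (encodeNat (rOf w)) (boolPair (ones 0) [])) := by
    simp [innerInit, fanoutFn_apply, rQ2, q2Arg, a1Arg, xArg, rOf]
  have hk : rOf w ≤ X.eval (q2Arg w pad ie ib).length := by
    rw [eval_X]; simp only [q2Arg, a1Arg, xArg, length_boolPair]; have := rOf_le w; omega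
  rw [inner3F, Function.comp_apply, Function.comp_apply, hinit, foldLoop_apply _ _ hk, sndPow_succ_boolPair,
    sndPow_succ_boolPair, sndPow_zero_boolPair, foldAcc_clipF, foldAcc_appF, List.nil_append]
  · unfold innerBits
    refine ccat_congr fun ia _ => ?_
    rw [Nat.zero_add]
    exact triple3F_q3Arg bit bv hbv w pad κe je κb jb κa ie ib ia
  · intro ia _ _
    rw [show boolPair (q2Arg w pad ie ib) (ones ia) = q3Arg w pad ie ib ia from rfl, triple3F_q3Arg bit bv hbv]
    simp only [tripleBits, List.length_cons, List.length_nil]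
    omega

/-- Value of a line. [folklore] -/
theorem lineF_q2Arg (w pad : List Bool) (κe : Kind) (je : ℕ) (κb : Kind) (jb : ℕ) (ie ib : ℕ) :
    lineF bit κe je κb jb (q2Arg w pad ie ib) = lineBits bv w κe je κb jb ie ib := by
  simp only [lineF, inner3F_q2Arg bit bv hbv, lineBits]

/-- Value of the middle piece. [folklore] -/
theorem midPieceF_q2Arg (w pad : List Bool) (κe : Kind) (je : ℕ) (κb : Kind) (ie ib : ℕ) :
    midPieceF bit κe je κb (q2Arg w pad ie ib) = midPieceBits bv w κe je κb ie ib := by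
  simp only [midPieceF, lineF_q2Arg bit bv hbv, midPieceBits]

/-- **Value of the middle fold** on `a₁` (unclipping: a piece has `36 r ≤ 36 (|a₁| + 1)` bits). [folklore] -/
theorem mid3F_a1Arg (w pad : List Bool) (κe : Kind) (je : ℕ) (κb : Kind) (ie : ℕ) :
    mid3F bit κe je κb (a1Arg w pad ie) = midBits bv w κe je κb ie := by
  have hinit : midInit (a1Arg w pad ie) =
      boolPair (a1Arg w pad ie) (boolPair (encodeNat (rOf w)) (boolPair (ones 0) [])) := by
    simp [midInit, fanoutFn_apply, rA1, a1Arg, xArg, rOf]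
  have hr := rOf_le w
  have hk : rOf w ≤ X.eval (a1Arg w pad ie).length := by
    rw [eval_X]; simp only [a1Arg, xArg, length_boolPair]; omega
  rw [mid3F, Function.comp_apply, Function.comp_apply, hinit, foldLoop_apply _ _ hk, sndPow_succ_boolPair,
    sndPow_succ_boolPair, sndPow_zero_boolPair, foldAcc_clipF, foldAcc_appF, List.nil_append]
  · unfold midBits
    refine ccat_congr fun ib _ => ?_
    rw [Nat.zero_add]
    exact midPieceF_q2Arg bit bv hbv w pad κe je κb ie ib
  · intro ib _ _
    rw [show boolPair (a1Arg w pad ie) (ones ib) = q2Arg w pad ie ib from rfl, midPieceF_q2Arg bit bv hbv,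
      length_midPieceBits]
    simp only [a1Arg, xArg, length_boolPair]
    nlinarith

/-- Value of a plane. [folklore] -/
theorem planeF_a1Arg (w pad : List Bool) (κe : Kind) (je : ℕ) (ie : ℕ) :
    planeF bit κe je (a1Arg w pad ie) = planeBits bv w κe je ie := by
  simp only [planeF, mid3F_a1Arg bit bv hbv, planeBits]

/-- Value of the outer piece. [folklore] -/
theorem outerPieceF_a1Arg (w pad : List Bool) (κe : Kind) (ie : ℕ) :
    outerPieceF bit κe (a1Arg w pad ie) = outerPieceBits bv w κe ie := by
  simp only [outerPieceF, planeF_a1Arg bit bv hbv, outerPieceBits]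

/-- **Value of the outer fold** on `x' = ⟨w, pad⟩` with a long pad (`|pad| ≥ (12 r)²`; unclipping: a
piece has `432 r² ≤ 432 (|x'| + 1)` bits). [folklore] -/
theorem outer3F_xArg (w pad : List Bool) (hpad : (4 * (rOf w * 3)) * (4 * (rOf w * 3)) ≤ pad.length) (κe : Kind) :
    outer3F bit κe (xArg w pad) = outerBits bv w κe := by
  have hinit : outerInit (xArg w pad) = boolPair (xArg w pad) (boolPair (encodeNat (rOf w)) (boolPair (ones 0) [])) := by
    simp [outerInit, fanoutFn_apply, rX, xArg, rOf]
  have hr := rOf_le w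
  have hk : rOf w ≤ X.eval (xArg w pad).length := by
    rw [eval_X]; simp only [xArg, length_boolPair]; omega
  rw [outer3F, Function.comp_apply, Function.comp_apply, hinit, foldLoop_apply _ _ hk, sndPow_succ_boolPair,
    sndPow_succ_boolPair, sndPow_zero_boolPair, foldAcc_clipF, foldAcc_appF, List.nil_append]
  · unfold outerBits
    refine ccat_congr fun ie _ => ?_
    rw [Nat.zero_add]
    exact outerPieceF_a1Arg bit bv hbv w pad κe ie
  · intro ie _ _
    rw [show boolPair (xArg w pad) (ones ie) = a1Arg w pad ie from rfl, outerPieceF_a1Arg bit bv hbv,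
      length_outerPieceBits]
    simp only [xArg, length_boolPair]
    nlinarith

/-- **Value of the cube** on `x' = ⟨w, pad⟩` with a long pad. [folklore] -/
theorem cubeOnF_xArg (w pad : List Bool) (hpad : (4 * (rOf w * 3)) * (4 * (rOf w * 3)) ≤ pad.length) :
    cubeOnF bit (xArg w pad) = cubeBits bv w := by
  simp only [cubeOnF, outer3F_xArg bit bv hbv w pad hpad, cubeBits]

end Values

/-! ### Values of the link fold (on `q = ⟨⟨w, 1ⁱ⟩, 1^{i'}⟩`, row clause `i`, column clause `i'`) -/

/-- **Value of the link bit** for row `(κ, i, j)` and column `(κ', i', j')`. [folklore] -/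
def linkBitVal (w : List Bool) (κ : Kind) (j : ℕ) (κ' : Kind) (j' : ℕ) (i i' : ℕ) : Bool :=
  match κ, κ' with
  | Kind.neg, Kind.pos => decide ((litOf w i j).1 = (litOf w i' j').1)
  | Kind.cl, Kind.v => decide (j = 0 ∧ j' = 0) && decide (i = i')
  | _, _ => false

/-- `linkBitF` on a genuine argument. [folklore] -/
theorem linkBitF_qArg (κ : Kind) (j : ℕ) (κ' : Kind) (j' : ℕ) (w : List Bool) (i i' : ℕ) :
    linkBitF κ j κ' j' (qArg w i i') = [linkBitVal w κ j κ' j' i i'] := by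
  cases κ <;> cases κ' <;> simp only [linkBitF, linkBitVal, sameVarF_qArg]
  case cl.v =>
    split_ifs with h
    · rw [eqClauseF_qArg]; simp [h]
    · simp [h]

/-- The link bits of the columns of kind `κ'` in row `(κ, i, j)`. [folklore] -/
def linkColBits (w : List Bool) (κ : Kind) (j : ℕ) (κ' : Kind) (i : ℕ) : List Bool :=
  ccat (fun i' => [linkBitVal w κ j κ' 0 i i', linkBitVal w κ j κ' 1 i i', linkBitVal w κ j κ' 2 i i']) (rOf w)
/-- A link row. [folklore] -/
def linkRowBits (w : List Bool) (κ : Kind) (j i : ℕ) : List Bool :=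
  linkColBits w κ j Kind.v i ++ linkColBits w κ j Kind.pos i ++ linkColBits w κ j Kind.neg i ++ linkColBits w κ j Kind.cl i
/-- A link group. [folklore] -/
def linkGroupBits (w : List Bool) (κ : Kind) (i : ℕ) : List Bool :=
  linkRowBits w κ 0 i ++ linkRowBits w κ 1 i ++ linkRowBits w κ 2 i
/-- A link block. [folklore] -/
def linkBlockBits (w : List Bool) (κ : Kind) : List Bool := ccat (linkGroupBits w κ) (rOf w)
/-- **The link bits read off `w`.** [folklore] -/
def linkBits (w : List Bool) : List Bool :=
  linkBlockBits w Kind.v ++ linkBlockBits w Kind.pos ++ linkBlockBits w Kind.neg ++ linkBlockBits w Kind.cl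

/-- `|linkColBits| = 3r`. [folklore] -/
theorem length_linkColBits (w : List Bool) (κ : Kind) (j : ℕ) (κ' : Kind) (i : ℕ) :
    (linkColBits w κ j κ' i).length = rOf w * 3 :=
  length_ccat_const (b := 3) (fun _ => rfl) _
/-- `|linkRowBits| = n`. [folklore] -/
theorem length_linkRowBits (w : List Bool) (κ : Kind) (j i : ℕ) : (linkRowBits w κ j i).length = 4 * (rOf w * 3) := by
  simp only [linkRowBits, List.length_append, length_linkColBits]; ring
/-- `|linkGroupBits| = 3n`. [folklore] -/
theorem length_linkGroupBits (w : List Bool) (κ : Kind) (i : ℕ) : (linkGroupBits w κ i).length = 3 * (4 * (rOf w * 3)) := by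
  simp only [linkGroupBits, List.length_append, length_linkRowBits]; ring
/-- `|linkBlockBits| = r · 3n`. [folklore] -/
theorem length_linkBlockBits (w : List Bool) (κ : Kind) : (linkBlockBits w κ).length = rOf w * (3 * (4 * (rOf w * 3))) :=
  length_ccat_const (length_linkGroupBits w κ) _
/-- `|linkBits| = n²`. [folklore] -/
theorem length_linkBits (w : List Bool) : (linkBits w).length = (4 * (rOf w * 3)) * (4 * (rOf w * 3)) := by
  simp only [linkBits, List.length_append, length_linkBlockBits]; ring

/-- Value of the link triple. [folklore] -/
theorem linkTripleF_qArg (κ : Kind) (j : ℕ) (κ' : Kind) (w : List Bool) (i i' : ℕ) :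
    linkTripleF κ j κ' (qArg w i i') = [linkBitVal w κ j κ' 0 i i', linkBitVal w κ j κ' 1 i i', linkBitVal w κ j κ' 2 i i'] := by
  simp [linkTripleF, linkBitF_qArg]

/-- **Value of the inner link fold** on `a = ⟨w, 1ⁱ⟩`. [folklore] -/
theorem linkInnerF_boolPair (κ : Kind) (j : ℕ) (κ' : Kind) (w : List Bool) (i : ℕ) :
    linkInnerF κ j κ' (boolPair w (ones i)) = linkColBits w κ j κ' i := by
  have hinit : colFoldInit (boolPair w (ones i)) =
      boolPair (boolPair w (ones i)) (boolPair (encodeNat (rOf w)) (boolPair (ones 0) [])) := by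
    simp [colFoldInit, fanoutFn_apply, rOf]
  have hk : rOf w ≤ X.eval (boolPair w (ones i)).length := by
    rw [eval_X, length_boolPair]; have := rOf_le w; omega
  rw [linkInnerF, Function.comp_apply, Function.comp_apply, hinit, foldLoop_apply _ _ hk, sndPow_succ_boolPair,
    sndPow_succ_boolPair, sndPow_zero_boolPair, foldAcc_clipF, foldAcc_appF, List.nil_append]
  · unfold linkColBits
    refine ccat_congr fun i' _ => ?_
    rw [Nat.zero_add]
    exact linkTripleF_qArg κ j κ' w i i'
  · intro i' _ _
    rw [show boolPair (boolPair w (ones i)) (ones i') = qArg w i i' from rfl, linkTripleF_qArg]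
    simp only [List.length_cons, List.length_nil]
    omega

/-- Value of a link row. [folklore] -/
theorem linkRowF_boolPair (κ : Kind) (j : ℕ) (w : List Bool) (i : ℕ) :
    linkRowF κ j (boolPair w (ones i)) = linkRowBits w κ j i := by
  simp only [linkRowF, linkInnerF_boolPair, linkRowBits]

/-- Value of a link group. [folklore] -/
theorem linkGroupF_boolPair (κ : Kind) (w : List Bool) (i : ℕ) : linkGroupF κ (boolPair w (ones i)) = linkGroupBits w κ i := by
  simp only [linkGroupF, linkRowF_boolPair, linkGroupBits]

/-- **Value of a link block.** [folklore] -/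
theorem linkBlockF_apply (κ : Kind) (w : List Bool) : linkBlockF κ w = linkBlockBits w κ := by
  have hinit : blockFoldInit w = boolPair w (boolPair (encodeNat (rOf w)) (boolPair (ones 0) [])) := by
    simp [blockFoldInit, fanoutFn_apply, rOf]
  have hk : rOf w ≤ X.eval w.length := by rw [eval_X]; exact rOf_le w
  rw [linkBlockF, Function.comp_apply, Function.comp_apply, hinit, foldLoop_apply _ _ hk, sndPow_succ_boolPair,
    sndPow_succ_boolPair, sndPow_zero_boolPair, foldAcc_clipF, foldAcc_appF, List.nil_append]
  · unfold linkBlockBits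
    refine ccat_congr fun i _ => ?_
    rw [Nat.zero_add, linkGroupF_boolPair]
  · intro i _ _
    rw [linkGroupF_boolPair, length_linkGroupBits, Cblk]
    have := rOf_le w
    nlinarith

/-- **Value of the link bits on every string.** [folklore] -/
theorem linkF_apply (w : List Bool) : linkF w = linkBits w := by
  simp only [linkF, linkBlockF_apply, linkBits]

/-- **Value of the sort-1 cube on every string** (the pad `linkF w` has `(12 r)²` symbols). [folklore] -/
theorem cubeAF_apply (w : List Bool) : cubeAF w = cubeBits bitAVal w := by
  rw [cubeAF, Function.comp_apply, show padArgF w = xArg w (linkF w) by simp [padArgF, xArg]]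
  exact cubeOnF_xArg bitAF bitAVal (bitAF_q3Arg) w _ (by rw [linkF_apply, length_linkBits])

/-- **Value of the sort-2 cube on every string.** [folklore] -/
theorem cubeBF_apply (w : List Bool) : cubeBF w = cubeBits bitBVal w := by
  rw [cubeBF, Function.comp_apply, show padArgF w = xArg w (linkF w) by simp [padArgF, xArg]]
  exact cubeOnF_xArg bitBF bitBVal (bitBF_q3Arg) w _ (by rw [linkF_apply, length_linkBits])

/-- **All table bits read off `w`** (the value of `tablesF`). [folklore] -/
def tablesBits (w : List Bool) : List Bool :=
  cubeBits bitAVal w ++ (cubeBits bitAVal w ++ (cubeBits bitBVal w ++ (cubeBits bitBVal w ++ (cubeBits bitBVal w ++ linkBits w))))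

/-- Value of `tablesF`. [folklore] -/
theorem tablesF_apply (w : List Bool) : tablesF w = tablesBits w := by
  simp only [tablesF, cubeAF_apply, cubeBF_apply, linkF_apply, tablesBits, List.append_assoc]

/-! ### The bits as nested `List.ofFn` over the numbered elements -/

section OfFn

variable (bv : BitVal) (w : List Bool)

/-- The cube bit at numbered elements `(a, b, e)`. [folklore] -/
def cubeBitAt (ua ub ue : Fin (4 * (rOf w * 3))) : Bool :=
  bv w (vertexEquiv (rOf w) ue).1 (vertexEquiv (rOf w) ue).2.2 (vertexEquiv (rOf w) ub).1 (vertexEquiv (rOf w) ub).2.2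
    (vertexEquiv (rOf w) ua).1 (vertexEquiv (rOf w) ua).2.2 (vertexEquiv (rOf w) ue).2.1 (vertexEquiv (rOf w) ub).2.1
    (vertexEquiv (rOf w) ua).2.1

/-- The link bit at numbered elements (column `a`, row `b`). [folklore] -/
def linkBitAt (ua ub : Fin (4 * (rOf w * 3))) : Bool :=
  linkBitVal w (vertexEquiv (rOf w) ub).1 (vertexEquiv (rOf w) ub).2.2 (vertexEquiv (rOf w) ua).1
    (vertexEquiv (rOf w) ua).2.2 (vertexEquiv (rOf w) ub).2.1 (vertexEquiv (rOf w) ua).2.1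

/-- A line is the `List.ofFn` over the elements `a`. [folklore] -/
theorem lineBits_eq_ofFn (τe : Fin 4) (ie : Fin (rOf w)) (je : Fin 3) (τb : Fin 4) (ib : Fin (rOf w)) (jb : Fin 3) :
    (List.ofFn fun ua => cubeBitAt bv w ua (finProdFinEquiv (τb, finProdFinEquiv (ib, jb)))
      (finProdFinEquiv (τe, finProdFinEquiv (ie, je)))) = lineBits bv w (kindEquiv τe) je (kindEquiv τb) jb ie ib := by
  rw [ofFn_vertices]
  simp only [cubeBitAt, vertexEquiv_apply, ofFn_four, ofFn_three, kindEquiv_zero, kindEquiv_one, kindEquiv_two,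
    kindEquiv_three, List.flatten_cons, List.flatten_nil, List.append_nil, lineBits, innerBits, tripleBits,
    ccat_eq_flatten_ofFn, List.append_assoc, Fin.val_zero, Fin.val_one, Fin.val_two]

/-- A plane is the flattened `List.ofFn` over the elements `b` of the lines. [folklore] -/
theorem planeBits_eq_ofFn (τe : Fin 4) (ie : Fin (rOf w)) (je : Fin 3) :
    (List.ofFn fun ub => List.ofFn fun ua => cubeBitAt bv w ua ub (finProdFinEquiv (τe, finProdFinEquiv (ie, je)))).flatten =
      planeBits bv w (kindEquiv τe) je ie := by
  rw [ofFn_vertices]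
  simp only [lineBits_eq_ofFn, ofFn_four, ofFn_three, kindEquiv_zero, kindEquiv_one, kindEquiv_two, kindEquiv_three,
    List.flatten_cons, List.flatten_nil, List.append_nil, List.flatten_append, planeBits, midBits, midPieceBits,
    ccat_eq_flatten_ofFn, List.append_assoc, Fin.val_zero, Fin.val_one, Fin.val_two, List.flatten_flatten,
    List.map_ofFn, Function.comp_def]

/-- **The cube is the doubly flattened `List.ofFn`** (outer `e`, middle `b`, inner `a`). [folklore] -/
theorem cubeBits_eq_ofFn :
    cubeBits bv w = (List.ofFn fun ue : Fin (4 * (rOf w * 3)) =>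
      (List.ofFn fun ub => List.ofFn fun ua => cubeBitAt bv w ua ub ue).flatten).flatten := by
  rw [ofFn_vertices]
  simp only [planeBits_eq_ofFn, ofFn_four, ofFn_three, kindEquiv_zero, kindEquiv_one, kindEquiv_two, kindEquiv_three,
    List.flatten_cons, List.flatten_nil, List.append_nil, List.flatten_append, cubeBits, outerBits, outerPieceBits,
    ccat_eq_flatten_ofFn, List.append_assoc, Fin.val_zero, Fin.val_one, Fin.val_two, List.flatten_flatten,
    List.map_ofFn, Function.comp_def]

/-- A link row is the `List.ofFn` over the columns. [folklore] -/
theorem linkRowBits_eq_ofFn (τ : Fin 4) (i : Fin (rOf w)) (j : Fin 3) :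
    (List.ofFn fun ua => linkBitAt w ua (finProdFinEquiv (τ, finProdFinEquiv (i, j)))) = linkRowBits w (kindEquiv τ) j i := by
  rw [ofFn_vertices]
  simp only [linkBitAt, vertexEquiv_apply, ofFn_four, ofFn_three, kindEquiv_zero, kindEquiv_one, kindEquiv_two,
    kindEquiv_three, List.flatten_cons, List.flatten_nil, List.append_nil, linkRowBits, linkColBits,
    ccat_eq_flatten_ofFn, List.append_assoc, Fin.val_zero, Fin.val_one, Fin.val_two]

/-- **The link bits are the flattened `List.ofFn`** (outer row `b`, inner column `a`). [folklore] -/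
theorem linkBits_eq_ofFn :
    linkBits w = (List.ofFn fun ub : Fin (4 * (rOf w * 3)) => List.ofFn fun ua => linkBitAt w ua ub).flatten := by
  rw [ofFn_vertices]
  simp only [linkRowBits_eq_ofFn, ofFn_four, ofFn_three, kindEquiv_zero, kindEquiv_one, kindEquiv_two, kindEquiv_three,
    List.flatten_cons, List.flatten_nil, List.append_nil, List.flatten_append, linkBits, linkBlockBits, linkGroupBits,
    ccat_eq_flatten_ofFn, List.append_assoc, Fin.val_zero, Fin.val_one, Fin.val_two, List.flatten_flatten,
    List.map_ofFn, Function.comp_def]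

end OfFn

/-! ### Layout of ternary and binary tables (`finFunctionFinEquiv`: first argument fastest) -/

/-- The digits of `a + n (b + n e)`. [folklore] -/
theorem finFunctionFinEquiv_symm_three {n : ℕ} (a b e : Fin n) (h : (a : ℕ) + n * ((b : ℕ) + n * (e : ℕ)) < n ^ 3) :
    finFunctionFinEquiv.symm (⟨(a : ℕ) + n * ((b : ℕ) + n * (e : ℕ)), h⟩ : Fin (n ^ 3)) = ![a, b, e] := by
  have hn : 0 < n := Fin.pos a
  funext k
  apply Fin.ext
  rw [finFunctionFinEquiv_symm_apply_val]
  match k with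
  | ⟨0, _⟩ =>
    show ((a : ℕ) + n * ((b : ℕ) + n * (e : ℕ))) / n ^ 0 % n = (a : ℕ)
    rw [pow_zero, Nat.div_one, Nat.add_mul_mod_self_left, Nat.mod_eq_of_lt a.2]
  | ⟨1, _⟩ =>
    show ((a : ℕ) + n * ((b : ℕ) + n * (e : ℕ))) / n ^ 1 % n = (b : ℕ)
    rw [pow_one, Nat.add_mul_div_left _ _ hn, Nat.div_eq_of_lt a.2, Nat.zero_add, Nat.add_mul_mod_self_left,
      Nat.mod_eq_of_lt b.2]
  | ⟨2, _⟩ =>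
    show ((a : ℕ) + n * ((b : ℕ) + n * (e : ℕ))) / n ^ 2 % n = (e : ℕ)
    rw [pow_two, ← Nat.div_div_eq_div_mul, Nat.add_mul_div_left _ _ hn, Nat.div_eq_of_lt a.2, Nat.zero_add,
      Nat.add_mul_div_left _ _ hn, Nat.div_eq_of_lt b.2, Nat.zero_add, Nat.mod_eq_of_lt e.2]

/-- The digits of `a + n b`. [folklore] -/
theorem finFunctionFinEquiv_symm_two {n : ℕ} (a b : Fin n) (h : (a : ℕ) + n * (b : ℕ) < n ^ 2) :
    finFunctionFinEquiv.symm (⟨(a : ℕ) + n * (b : ℕ), h⟩ : Fin (n ^ 2)) = ![a, b] := by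
  have hn : 0 < n := Fin.pos a
  funext k
  apply Fin.ext
  rw [finFunctionFinEquiv_symm_apply_val]
  match k with
  | ⟨0, _⟩ =>
    show ((a : ℕ) + n * (b : ℕ)) / n ^ 0 % n = (a : ℕ)
    rw [pow_zero, Nat.div_one, Nat.add_mul_mod_self_left, Nat.mod_eq_of_lt a.2]
  | ⟨1, _⟩ =>
    show ((a : ℕ) + n * (b : ℕ)) / n ^ 1 % n = (b : ℕ)
    rw [pow_one, Nat.add_mul_div_left _ _ hn, Nat.div_eq_of_lt a.2, Nat.zero_add, Nat.mod_eq_of_lt b.2]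

/-- **Layout of a ternary table**: the `List.ofFn` over `Fin (n³)` through `finFunctionFinEquiv⁻¹` is the
doubly flattened list, third argument slowest, first fastest. [folklore] -/
theorem ofFn_table_three {α : Type} {n : ℕ} (G : (Fin 3 → Fin n) → α) :
    List.ofFn (fun p : Fin (n ^ 3) => G (finFunctionFinEquiv.symm p)) =
      (List.ofFn fun e : Fin n => (List.ofFn fun b : Fin n => List.ofFn fun a : Fin n => G ![a, b, e]).flatten).flatten := by
  have h3 : n ^ 3 = n * (n * n) := by ring
  rw [List.ofFn_congr h3, List.ofFn_mul]
  refine congrArg List.flatten (congrArg List.ofFn (funext fun e => ?_))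
  rw [List.ofFn_mul]
  refine congrArg List.flatten (congrArg List.ofFn (funext fun b => congrArg List.ofFn (funext fun a => ?_)))
  have hlt : (a : ℕ) + n * ((b : ℕ) + n * (e : ℕ)) < n ^ 3 := by
    have := (finProdFinEquiv (e, finProdFinEquiv (b, a))).2
    rw [finProdFinEquiv_apply_val, finProdFinEquiv_apply_val] at this
    rw [h3]; simp only at this; linarith
  rw [← finFunctionFinEquiv_symm_three a b e hlt]
  exact congrArg G (congrArg _ (Fin.ext (by simp only [Fin.val_cast]; ring)))

/-- **Layout of a binary table**: second argument slowest. [folklore] -/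
theorem ofFn_table_two {α : Type} {n : ℕ} (G : (Fin 2 → Fin n) → α) :
    List.ofFn (fun p : Fin (n ^ 2) => G (finFunctionFinEquiv.symm p)) =
      (List.ofFn fun b : Fin n => List.ofFn fun a : Fin n => G ![a, b]).flatten := by
  have h2 : n ^ 2 = n * n := by ring
  rw [List.ofFn_congr h2, List.ofFn_mul]
  refine congrArg List.flatten (congrArg List.ofFn (funext fun b => congrArg List.ofFn (funext fun a => ?_)))
  have hlt : (a : ℕ) + n * (b : ℕ) < n ^ 2 := by
    have := (finProdFinEquiv (b, a)).2
    rw [finProdFinEquiv_apply_val] at this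
    rw [h2]; linarith
  rw [← finFunctionFinEquiv_symm_two a b hlt]
  exact congrArg G (congrArg _ (Fin.ext (by simp only [Fin.val_cast]; ring)))

/-! ### The bits are the tables of the gadget structure of the slot literals read off `w` -/

open LPTables LPRed

/-- **The table instance emitted**: the gadget structure of the slot literals read off `w`, its
`12 r` elements numbered by `vertexEquiv`. [cite: LichterPago2025, Lemmas 3.18–3.19] -/
def tablesOfCode (w : List Bool) : RelTables lpVocab (4 * (rOf w * 3)) :=
  pullTables (gadget (litFamily w)) (vertexEquiv (rOf w))

/-- Unfolding an entry of `tablesOfCode`. [folklore] -/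
theorem tablesOfCode_apply (w : List Bool) (s : Fin lpVocab.length) (x : Fin (lpVocab.get s) → Fin (4 * (rOf w * 3))) :
    tablesOfCode w s x = @decide (@FirstOrder.Language.Structure.RelMap orLinLanguage (Vtx (rOf w))
      (gadget (litFamily w)) _ (sym s) (vertexEquiv (rOf w) ∘ x)) (Classical.propDecidable _) := by
  unfold tablesOfCode pullTables
  congr 1

/-- **Membership in a sort-1 clause tuple, coordinatewise**: `x = p_{i,t}` iff `x` is in clause `i` and
satisfies the sort-1 condition. [folklore] -/
theorem eq_tuple₁_iff (w : List Bool) (x : Vtx (rOf w)) (i : Fin (rOf w)) (t : Fin 3) :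
    x = tuple₁ (litFamily w) i t ↔ x.2.1 = i ∧ condAVal w t x.1 x.2.2 i = true := by
  obtain ⟨κ, i', j⟩ := x
  simp only [tuple₁, litFamily]
  rcases Bool.eq_false_or_eq_true ((litOf w i t).2) with hp | hp
  · rw [if_pos hp]
    constructor
    · intro h
      simp only [Prod.mk.injEq] at h
      obtain ⟨rfl, rfl, rfl⟩ := h
      exact ⟨rfl, by simp [condAVal, hp]⟩
    · rintro ⟨h1, h2⟩
      obtain rfl : i' = i := h1
      cases κ <;> simp [condAVal, hp] at h2
      simp only [Prod.mk.injEq, true_and]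
      exact Fin.ext h2
  · have hp' : ¬ (litOf w i t).2 = true := by rw [hp]; exact Bool.false_ne_true
    rw [if_neg hp']
    constructor
    · intro h
      simp only [Prod.mk.injEq] at h
      obtain ⟨rfl, rfl, rfl⟩ := h
      exact ⟨rfl, by simp [condAVal, hp]⟩
    · rintro ⟨h1, h2⟩
      obtain rfl : i' = i := h1
      cases κ <;> simp [condAVal, hp] at h2
      simp only [Prod.mk.injEq, true_and]
      exact h2

/-- The same for sort 2. [folklore] -/
theorem eq_tuple₂_iff (w : List Bool) (x : Vtx (rOf w)) (i : Fin (rOf w)) (t : Fin 3) :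
    x = tuple₂ (litFamily w) i t ↔ x.2.1 = i ∧ condBVal w t x.1 x.2.2 i = true := by
  obtain ⟨κ, i', j⟩ := x
  simp only [tuple₂, litFamily]
  rcases Bool.eq_false_or_eq_true ((litOf w i t).2) with hp | hp
  · have hp' : ¬ (litOf w i t).2 = false := by rw [hp]; exact Bool.noConfusion
    rw [if_neg hp']
    constructor
    · intro h
      simp only [Prod.mk.injEq] at h
      obtain ⟨rfl, rfl, rfl⟩ := h
      exact ⟨rfl, by simp [condBVal, hp]⟩
    · rintro ⟨h1, h2⟩
      obtain rfl : i' = i := h1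
      cases κ <;> simp [condBVal, hp] at h2
      simp only [Prod.mk.injEq, true_and]
      exact h2
  · rw [if_pos hp]
    constructor
    · intro h
      simp only [Prod.mk.injEq] at h
      obtain ⟨rfl, rfl, rfl⟩ := h
      exact ⟨rfl, by simp [condBVal, hp]⟩
    · rintro ⟨h1, h2⟩
      obtain rfl : i' = i := h1
      cases κ <;> simp [condBVal, hp] at h2
      simp only [Prod.mk.injEq, true_and]
      exact Fin.ext h2

/-- Two functions on `Fin 3` agree iff their three values do. [folklore] -/
private theorem fun_eq_iff_three {α : Type} (f g : Fin 3 → α) : f = g ↔ f 0 = g 0 ∧ f 1 = g 1 ∧ f 2 = g 2 := by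
  constructor
  · rintro rfl; exact ⟨rfl, rfl, rfl⟩
  · rintro ⟨h0, h1, h2⟩
    funext k
    match k with
    | ⟨0, _⟩ => exact h0
    | ⟨1, _⟩ => exact h1
    | ⟨2, _⟩ => exact h2

/-- **The sort-1 clause relation is the table bit `bitAVal`.** [cite: LichterPago2025, Lemma 3.18 (proof)] -/
theorem rel₁_iff_bitAVal (w : List Bool) (x : Fin 3 → Vtx (rOf w)) :
    (∃ i, x = tuple₁ (litFamily w) i) ↔
      bitAVal w (x 2).1 (x 2).2.2 (x 1).1 (x 1).2.2 (x 0).1 (x 0).2.2 (x 2).2.1 (x 1).2.1 (x 0).2.1 = true := by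
  simp only [fun_eq_iff_three, eq_tuple₁_iff, bitAVal, Bool.and_eq_true, decide_eq_true_eq, Fin.val_zero,
    Fin.val_one, Fin.val_two]
  constructor
  · rintro ⟨i, ⟨h0, c0⟩, ⟨h1, c1⟩, ⟨h2, c2⟩⟩
    subst h0
    exact ⟨⟨by rw [h2, h1], by rw [h1]⟩, ⟨c0, c1⟩, c2⟩
  · rintro ⟨⟨h21, h10⟩, ⟨c0, c1⟩, c2⟩
    have e1 : (x 1).2.1 = (x 0).2.1 := Fin.ext h10
    have e2 : (x 2).2.1 = (x 0).2.1 := Fin.ext (h21.trans h10)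
    exact ⟨(x 0).2.1, ⟨rfl, c0⟩, ⟨e1, c1⟩, ⟨e2, c2⟩⟩

/-- **The sort-2 clause relation is the table bit `bitBVal`.** [cite: LichterPago2025, Lemma 3.18 (proof)] -/
theorem rel₂_iff_bitBVal (w : List Bool) (x : Fin 3 → Vtx (rOf w)) :
    (∃ i, x = tuple₂ (litFamily w) i) ↔
      bitBVal w (x 2).1 (x 2).2.2 (x 1).1 (x 1).2.2 (x 0).1 (x 0).2.2 (x 2).2.1 (x 1).2.1 (x 0).2.1 = true := by
  simp only [fun_eq_iff_three, eq_tuple₂_iff, bitBVal, Bool.and_eq_true, decide_eq_true_eq, Fin.val_zero,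
    Fin.val_one, Fin.val_two]
  constructor
  · rintro ⟨i, ⟨h0, c0⟩, ⟨h1, c1⟩, ⟨h2, c2⟩⟩
    subst h0
    exact ⟨⟨by rw [h2, h1], by rw [h1]⟩, ⟨c0, c1⟩, c2⟩
  · rintro ⟨⟨h21, h10⟩, ⟨c0, c1⟩, c2⟩
    have e1 : (x 1).2.1 = (x 0).2.1 := Fin.ext h10
    have e2 : (x 2).2.1 = (x 0).2.1 := Fin.ext (h21.trans h10)
    exact ⟨(x 0).2.1, ⟨rfl, c0⟩, ⟨e1, c1⟩, ⟨e2, c2⟩⟩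

/-- The link relation by kinds. [folklore] -/
theorem linkRel_iff' {r : ℕ} (L : Slot r → Literal ℕ) (κa : Kind) (pa : Slot r) (κb : Kind) (pb : Slot r) :
    LinkRel L (κa, pa) (κb, pb) ↔ (κa = Kind.pos ∧ κb = Kind.neg ∧ (L pa).1 = (L pb).1) ∨
      (κa = Kind.v ∧ κb = Kind.cl ∧ pa.2 = 0 ∧ pb.2 = 0 ∧ pa.1 = pb.1) := by
  constructor
  · rintro (⟨p, q, hp, hq, h⟩ | ⟨i, hp, hq⟩)
    · simp only [Prod.mk.injEq] at hp hq
      obtain ⟨rfl, rfl⟩ := hp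
      obtain ⟨rfl, rfl⟩ := hq
      exact Or.inl ⟨rfl, rfl, h⟩
    · simp only [Prod.mk.injEq] at hp hq
      obtain ⟨rfl, rfl⟩ := hp
      obtain ⟨rfl, rfl⟩ := hq
      exact Or.inr ⟨rfl, rfl, rfl, rfl, rfl⟩
  · rintro (⟨rfl, rfl, h⟩ | ⟨rfl, rfl, h1, h2, h3⟩)
    · exact Or.inl ⟨pa, pb, rfl, rfl, h⟩
    · refine Or.inr ⟨pa.1, Prod.ext rfl (Prod.ext rfl h1), Prod.ext rfl (Prod.ext h3.symm h2)⟩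

/-- **The link relation is the table bit `linkBitVal`** (row = second coordinate). [cite: LichterPago2025, Lemma 3.18 (proof)] -/
theorem linkRel_iff_linkBitVal (w : List Bool) (a b : Vtx (rOf w)) :
    LinkRel (litFamily w) a b ↔ linkBitVal w b.1 b.2.2 a.1 a.2.2 b.2.1 a.2.1 = true := by
  obtain ⟨κa, ia, ja⟩ := a
  obtain ⟨κb, ib, jb⟩ := b
  rw [linkRel_iff']
  simp only [litFamily]
  cases κa <;> cases κb <;> simp only [linkBitVal, reduceCtorEq, true_and, false_and, or_false, false_or,
    iff_self, decide_eq_true_eq, Bool.and_eq_true, Bool.false_eq_true]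
  case pos.neg => exact eq_comm
  case v.cl =>
    constructor
    · rintro ⟨h1, h2, h3⟩
      rw [h1, h2, h3]
      exact ⟨⟨rfl, rfl⟩, rfl⟩
    · rintro ⟨⟨h1, h2⟩, h3⟩
      exact ⟨Fin.ext h2, Fin.ext h1, Fin.ext h3.symm⟩

/-- `tableBits lpVocab n = 5 n³ + n²`. [folklore] -/
theorem tableBits_lpVocab (n : ℕ) : tableBits lpVocab n = 5 * n ^ 3 + n ^ 2 := by
  simp [tableBits, lpVocab, Fin.sum_univ_succ, List.get_eq_getElem]; ring

/-- The table offsets of `lpVocab`: `k n³` for the symbol number `k ≤ 5`. [folklore] -/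
theorem tableOffset_lpVocab (n : ℕ) (s : Fin lpVocab.length) : tableOffset lpVocab n s = (s : ℕ) * n ^ 3 := by
  match s with
  | ⟨0, _⟩ => simp [tableOffset]
  | ⟨1, _⟩ => simp [tableOffset, lpVocab, List.get_eq_getElem]
  | ⟨2, _⟩ => simp [tableOffset, lpVocab, Fin.sum_univ_succ, List.get_eq_getElem]; ring
  | ⟨3, _⟩ => simp [tableOffset, lpVocab, Fin.sum_univ_succ, List.get_eq_getElem]; ring
  | ⟨4, _⟩ => simp [tableOffset, lpVocab, Fin.sum_univ_succ, List.get_eq_getElem]; ring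
  | ⟨5, _⟩ => simp [tableOffset, lpVocab, Fin.sum_univ_succ, List.get_eq_getElem]; ring

/-- `|tablesBits w| = tableBits lpVocab n`. [folklore] -/
theorem length_tablesBits (w : List Bool) : (tablesBits w).length = tableBits lpVocab (4 * (rOf w * 3)) := by
  simp only [tablesBits, List.length_append, length_cubeBits, length_linkBits, tableBits_lpVocab]; ring

/-- A cube as the `List.ofFn` over `Fin (n³)` of its ternary table. [folklore] -/
theorem cubeBits_eq_ofFn_table (bv : BitVal) (w : List Bool) :
    cubeBits bv w = List.ofFn (fun p : Fin ((4 * (rOf w * 3)) ^ 3) =>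
      cubeBitAt bv w (finFunctionFinEquiv.symm p 0) (finFunctionFinEquiv.symm p 1) (finFunctionFinEquiv.symm p 2)) := by
  rw [cubeBits_eq_ofFn, ofFn_table_three (fun y => cubeBitAt bv w (y 0) (y 1) (y 2))]
  rfl

/-- The link bits as the `List.ofFn` over `Fin (n²)` of the binary table. [folklore] -/
theorem linkBits_eq_ofFn_table (w : List Bool) :
    linkBits w = List.ofFn (fun p : Fin ((4 * (rOf w * 3)) ^ 2) =>
      linkBitAt w (finFunctionFinEquiv.symm p 0) (finFunctionFinEquiv.symm p 1)) := by
  rw [linkBits_eq_ofFn, ofFn_table_two (fun y => linkBitAt w (y 0) (y 1))]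
  rfl

/-- Reading a cube entry. [folklore] -/
theorem getElem_cubeBits (bv : BitVal) (w : List Bool) (x : Fin 3 → Fin (4 * (rOf w * 3)))
    (h : (finFunctionFinEquiv x : ℕ) < (cubeBits bv w).length) :
    (cubeBits bv w)[(finFunctionFinEquiv x : ℕ)] = cubeBitAt bv w (x 0) (x 1) (x 2) := by
  rw [List.getElem_of_eq (cubeBits_eq_ofFn_table bv w), List.getElem_ofFn]
  simp only [Fin.eta, Equiv.symm_apply_apply]

/-- Reading a link entry. [folklore] -/
theorem getElem_linkBits (w : List Bool) (x : Fin 2 → Fin (4 * (rOf w * 3)))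
    (h : (finFunctionFinEquiv x : ℕ) < (linkBits w).length) :
    (linkBits w)[(finFunctionFinEquiv x : ℕ)] = linkBitAt w (x 0) (x 1) := by
  rw [List.getElem_of_eq (linkBits_eq_ofFn_table w), List.getElem_ofFn]
  simp only [Fin.eta, Equiv.symm_apply_apply]

section Blocks

variable (w : List Bool)

/-- Skipping a leading block of the table bits. [folklore] -/
private theorem getElem_skip (A rest : List Bool) (q : ℕ) (h : A.length + q < (A ++ rest).length) :
    (A ++ rest)[A.length + q] = rest[q]'(by rw [List.length_append] at h; omega) := by
  rw [List.getElem_append_right (by omega)]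
  simp only [Nat.add_sub_cancel_left]

/-- Block 0 of the table bits. [folklore] -/
theorem getElem_tablesBits_zero (q : ℕ) (hq : q < (cubeBits bitAVal w).length) (h : 0 * (4 * (rOf w * 3)) ^ 3 + q < (tablesBits w).length) :
    (tablesBits w)[0 * (4 * (rOf w * 3)) ^ 3 + q] = (cubeBits bitAVal w)[q] := by
  simp only [Nat.zero_mul, Nat.zero_add, tablesBits]
  exact List.getElem_append_left hq

/-- Block 1 of the table bits. [folklore] -/
theorem getElem_tablesBits_one (q : ℕ) (hq : q < (cubeBits bitAVal w).length) (h : 1 * (4 * (rOf w * 3)) ^ 3 + q < (tablesBits w).length) :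
    (tablesBits w)[1 * (4 * (rOf w * 3)) ^ 3 + q] = (cubeBits bitAVal w)[q] := by
  have hA : (cubeBits bitAVal w).length = (4 * (rOf w * 3)) ^ 3 := by rw [length_cubeBits]; ring
  have h' : (cubeBits bitAVal w).length + q < (tablesBits w).length := by rw [hA]; omega
  calc (tablesBits w)[1 * (4 * (rOf w * 3)) ^ 3 + q]
      = (tablesBits w)[(cubeBits bitAVal w).length + q]'h' := by congr 1; rw [hA]; ring
    _ = (cubeBits bitAVal w)[q] := by
      unfold tablesBits
      rw [getElem_skip]
      exact List.getElem_append_left hq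

/-- Block 2 of the table bits. [folklore] -/
theorem getElem_tablesBits_two (q : ℕ) (hq : q < (cubeBits bitBVal w).length) (h : 2 * (4 * (rOf w * 3)) ^ 3 + q < (tablesBits w).length) :
    (tablesBits w)[2 * (4 * (rOf w * 3)) ^ 3 + q] = (cubeBits bitBVal w)[q] := by
  have hA : (cubeBits bitAVal w).length = (4 * (rOf w * 3)) ^ 3 := by rw [length_cubeBits]; ring
  have h' : (cubeBits bitAVal w).length + ((cubeBits bitAVal w).length + q) < (tablesBits w).length := by rw [hA]; omega
  calc (tablesBits w)[2 * (4 * (rOf w * 3)) ^ 3 + q]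
      = (tablesBits w)[(cubeBits bitAVal w).length + ((cubeBits bitAVal w).length + q)]'h' := by congr 1; rw [hA]; ring
    _ = (cubeBits bitBVal w)[q] := by
      unfold tablesBits
      rw [getElem_skip, getElem_skip]
      exact List.getElem_append_left hq

/-- Block 3 of the table bits. [folklore] -/
theorem getElem_tablesBits_three (q : ℕ) (hq : q < (cubeBits bitBVal w).length) (h : 3 * (4 * (rOf w * 3)) ^ 3 + q < (tablesBits w).length) :
    (tablesBits w)[3 * (4 * (rOf w * 3)) ^ 3 + q] = (cubeBits bitBVal w)[q] := by
  have hA : (cubeBits bitAVal w).length = (4 * (rOf w * 3)) ^ 3 := by rw [length_cubeBits]; ring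
  have hB : (cubeBits bitBVal w).length = (4 * (rOf w * 3)) ^ 3 := by rw [length_cubeBits]; ring
  have h' : (cubeBits bitAVal w).length + ((cubeBits bitAVal w).length + ((cubeBits bitBVal w).length + q)) <
      (tablesBits w).length := by rw [hA, hB]; omega
  calc (tablesBits w)[3 * (4 * (rOf w * 3)) ^ 3 + q]
      = (tablesBits w)[(cubeBits bitAVal w).length + ((cubeBits bitAVal w).length + ((cubeBits bitBVal w).length + q))]'h' := by
        congr 1; rw [hA, hB]; ring
    _ = (cubeBits bitBVal w)[q] := by
      unfold tablesBits
      rw [getElem_skip, getElem_skip, getElem_skip]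
      exact List.getElem_append_left hq

/-- Block 4 of the table bits. [folklore] -/
theorem getElem_tablesBits_four (q : ℕ) (hq : q < (cubeBits bitBVal w).length) (h : 4 * (4 * (rOf w * 3)) ^ 3 + q < (tablesBits w).length) :
    (tablesBits w)[4 * (4 * (rOf w * 3)) ^ 3 + q] = (cubeBits bitBVal w)[q] := by
  have hA : (cubeBits bitAVal w).length = (4 * (rOf w * 3)) ^ 3 := by rw [length_cubeBits]; ring
  have hB : (cubeBits bitBVal w).length = (4 * (rOf w * 3)) ^ 3 := by rw [length_cubeBits]; ring
  have h' : (cubeBits bitAVal w).length + ((cubeBits bitAVal w).length + ((cubeBits bitBVal w).length +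
      ((cubeBits bitBVal w).length + q))) < (tablesBits w).length := by rw [hA, hB]; omega
  calc (tablesBits w)[4 * (4 * (rOf w * 3)) ^ 3 + q]
      = (tablesBits w)[(cubeBits bitAVal w).length + ((cubeBits bitAVal w).length + ((cubeBits bitBVal w).length +
          ((cubeBits bitBVal w).length + q)))]'h' := by
        congr 1; rw [hA, hB]; ring
    _ = (cubeBits bitBVal w)[q] := by
      unfold tablesBits
      rw [getElem_skip, getElem_skip, getElem_skip, getElem_skip]
      exact List.getElem_append_left hq

/-- Block 5 of the table bits (the link table). [folklore] -/
theorem getElem_tablesBits_five (q : ℕ) (hq : q < (linkBits w).length) (h : 5 * (4 * (rOf w * 3)) ^ 3 + q < (tablesBits w).length) :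
    (tablesBits w)[5 * (4 * (rOf w * 3)) ^ 3 + q] = (linkBits w)[q] := by
  have hA : (cubeBits bitAVal w).length = (4 * (rOf w * 3)) ^ 3 := by rw [length_cubeBits]; ring
  have hB : (cubeBits bitBVal w).length = (4 * (rOf w * 3)) ^ 3 := by rw [length_cubeBits]; ring
  have h' : (cubeBits bitAVal w).length + ((cubeBits bitAVal w).length + ((cubeBits bitBVal w).length +
      ((cubeBits bitBVal w).length + ((cubeBits bitBVal w).length + q)))) < (tablesBits w).length := by rw [hA, hB]; omega
  calc (tablesBits w)[5 * (4 * (rOf w * 3)) ^ 3 + q]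
      = (tablesBits w)[(cubeBits bitAVal w).length + ((cubeBits bitAVal w).length + ((cubeBits bitBVal w).length +
          ((cubeBits bitBVal w).length + ((cubeBits bitBVal w).length + q))))]'h' := by
        congr 1; rw [hA, hB]; ring
    _ = (linkBits w)[q] := by
      unfold tablesBits
      rw [getElem_skip, getElem_skip, getElem_skip, getElem_skip, getElem_skip]

end Blocks

/-- `vertexEquiv ∘ x` on `Fin 3` as a clause tuple. [folklore] -/
private theorem decide_congr_iff {P : Prop} {b : Bool} (d : Decidable P) (h : P ↔ b = true) : @decide P d = b := by
  cases b
  · simp only [Bool.false_eq_true, iff_false] at h; exact @decide_eq_false P d h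
  · exact @decide_eq_true P d (h.2 rfl)

/-- **The table bits read off `w` are the tables of the gadget structure.** [cite: LichterPago2025, Lemmas 3.18–3.19] -/
theorem tablesOfBits_tablesBits (w : List Bool) :
    tablesOfBits lpVocab (4 * (rOf w * 3)) (tablesBits w) (length_tablesBits w) = tablesOfCode w := by
  have hA3 : ∀ x : Fin 3 → Fin (4 * (rOf w * 3)), (finFunctionFinEquiv x : ℕ) < (cubeBits bitAVal w).length := by
    intro x; rw [length_cubeBits]; convert (finFunctionFinEquiv x).2 using 1; ring
  have hB3 : ∀ x : Fin 3 → Fin (4 * (rOf w * 3)), (finFunctionFinEquiv x : ℕ) < (cubeBits bitBVal w).length := by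
    intro x; rw [length_cubeBits]; convert (finFunctionFinEquiv x).2 using 1; ring
  have hL2 : ∀ x : Fin 2 → Fin (4 * (rOf w * 3)), (finFunctionFinEquiv x : ℕ) < (linkBits w).length := by
    intro x; rw [length_linkBits]; convert (finFunctionFinEquiv x).2 using 1; ring
  funext s x
  rw [ChromaticNP.tablesOfBits_apply, tablesOfCode_apply]
  simp only [tableOffset_lpVocab]
  match s with
  | ⟨0, _⟩ =>
    exact (getElem_tablesBits_zero w _ (hA3 x) _).trans ((getElem_cubeBits bitAVal w x (hA3 x)).trans
      (decide_congr_iff _ (rel₁_iff_bitAVal w (vertexEquiv (rOf w) ∘ x))).symm)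
  | ⟨1, _⟩ =>
    exact (getElem_tablesBits_one w _ (hA3 x) _).trans ((getElem_cubeBits bitAVal w x (hA3 x)).trans
      (decide_congr_iff _ (rel₁_iff_bitAVal w (vertexEquiv (rOf w) ∘ x))).symm)
  | ⟨2, _⟩ =>
    exact (getElem_tablesBits_two w _ (hB3 x) _).trans ((getElem_cubeBits bitBVal w x (hB3 x)).trans
      (decide_congr_iff _ (rel₂_iff_bitBVal w (vertexEquiv (rOf w) ∘ x))).symm)
  | ⟨3, _⟩ =>
    exact (getElem_tablesBits_three w _ (hB3 x) _).trans ((getElem_cubeBits bitBVal w x (hB3 x)).trans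
      (decide_congr_iff _ (rel₂_iff_bitBVal w (vertexEquiv (rOf w) ∘ x))).symm)
  | ⟨4, _⟩ =>
    exact (getElem_tablesBits_four w _ (hB3 x) _).trans ((getElem_cubeBits bitBVal w x (hB3 x)).trans
      (decide_congr_iff _ (rel₂_iff_bitBVal w (vertexEquiv (rOf w) ∘ x))).symm)
  | ⟨5, _⟩ =>
    exact (getElem_tablesBits_five w _ (hL2 x) _).trans ((getElem_linkBits w x (hL2 x)).trans
      (decide_congr_iff _ (linkRel_iff_linkBitVal w _ _)).symm)

/-- **The map emits the code of the table instance of the gadget structure, on every string.**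
[cite: LichterPago2025, Lemmas 3.18–3.19] -/
theorem lpKarpFn_eq_encode (w : List Bool) :
    lpKarpFn w = (encodingSNPInstance lpVocab).encode (⟨4 * (rOf w * 3), tablesOfCode w⟩ : SNPInstance lpVocab) := by
  have h3 : threeRF w = encodeNat (rOf w * 3) := by simp [threeRF, fanoutFn_apply, rOf]
  have hk : lpKarpFn w = boolPair (encodeNat (4 * (rOf w * 3))) (tablesF w) := by
    simp [lpKarpFn, vertexNumF, fanoutFn_apply, h3]
  rw [hk, tablesF_apply, ← tablesOfBits_tablesBits]
  change _ = boolPair (encodeNat (4 * (rOf w * 3))) ((encodingRelTables lpVocab (4 * (rOf w * 3))).encode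
    (tablesOfBits lpVocab _ (tablesBits w) (length_tablesBits w)))
  rw [encode_tablesOfBits]

/-! ### The reduction -/

/-- Slot-satisfiability depends only on the slot literals (transport along `r = r'`). [folklore] -/
theorem slotSat_congr {r r' : ℕ} (h : r = r') {L : Slot r → Literal ℕ} {L' : Slot r' → Literal ℕ}
    (hL : ∀ (i : Fin r) (j : Fin 3), L (i, j) = L' (Fin.cast h i, j)) : SlotSat L ↔ SlotSat L' := by
  subst h
  have : L = L' := funext fun p => by
    obtain ⟨i, j⟩ := p
    rw [hL]; rfl
  rw [this]

/-- **On the code of a CNF of width `≤ 3` without empty clauses, the emitted instance is satisfiable iff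
the CNF is.** [cite: LichterPago2025, Lemmas 3.18–3.19] -/
theorem hasHomTo_tablesOfCode_encode_iff (φ : CNF ℕ) (hw : φ.IsWidthLE 3) (hne : ∀ c ∈ φ, c ≠ []) :
    HasHomTo (tablesOfCode (encodingCNF.encode φ)) lpTemplate ↔ φ.Satisfiable := by
  have hr := rOf_encode φ
  rw [tablesOfCode, hasHomTo_pullTables_iff, nonempty_hom_iff,
    slotSat_congr hr (L' := slotLit φ) (fun i j => ?_), slotSat_iff_satisfiable φ hw (fun h => hne [] h rfl)]
  have hi : i.val < φ.length := hr ▸ i.2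
  exact litOf_encode φ hi (hne _ (List.getElem_mem hi)) j

/-- A member of `cspLanguage lpTemplate` is a genuine pair, of length `≥ 2`; so `[1]` is not a member.
[folklore] -/
theorem singleton_not_mem_cspLanguage : [true] ∉ cspLanguage lpTemplate := by
  rintro ⟨x, -, h⟩
  have := congrArg List.length h
  rw [Literature.Computability.Cryptography.length_encodingSNPInstance_encode] at this
  simp at this
  omega

/-- **`3SAT ≤ₚ CSP(OR_⊥(𝔽₂-equations, 𝔽₃-equations))`**: the template `lpTemplate` of Lichter–Pago's
Theorem 5.9 is NP-hard. [cite: LichterPago2025, Lemmas 3.18–3.19, Thm 5.9] -/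
theorem kSAT_three_karpReducible_cspLanguage : kSAT 3 ≤ₚ cspLanguage lpTemplate := by
  refine ⟨toLPFn, toLPFn_mem_FP, fun x => ?_⟩
  show x ∈ kSAT 3 ↔ toLPFn x ∈ cspLanguage lpTemplate
  by_cases hx : encodingCNF.encode (NegCNF.decCNF x) = x
  · generalize NegCNF.decCNF x = φ at hx
    subst hx
    rw [mem_kSAT_iff]
    by_cases hg : φ.IsWidthLE 3 ∧ ∀ c ∈ φ, c ≠ []
    · have hgt : guard3F (encodingCNF.encode φ) = [true] := by
        rw [guard3F_encode, decide_eq_true hg.1, decide_eq_true hg.2, Bool.and_self]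
      rw [toLPFn, iteFn_apply_true hgt, lpKarpFn_eq_encode, encode_mem_cspLanguage_iff]
      show _ ↔ HasHomTo (tablesOfCode (encodingCNF.encode φ)) lpTemplate
      rw [hasHomTo_tablesOfCode_encode_iff φ hg.1 hg.2]
      exact ⟨fun h => h.2, fun h => ⟨hg.1, h⟩⟩
    · have hgf : guard3F (encodingCNF.encode φ) = [false] := by
        rw [guard3F_encode]
        by_cases hW : φ.IsWidthLE 3
        · have hN : ¬ ∀ c ∈ φ, c ≠ [] := fun h => hg ⟨hW, h⟩
          simp [hW, hN]
        · simp [hW]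
      rw [toLPFn, iteFn_apply_false hgf]
      constructor
      · rintro ⟨hw', hsat⟩
        exfalso
        refine hg ⟨hw', fun c hc hnil => ?_⟩
        subst hnil
        exact CNF.not_satisfiable_of_nil_mem hc hsat
      · intro h
        exact absurd h singleton_not_mem_cspLanguage
  · rw [toLPFn, iteFn_apply_false (guard3F_of_not_canon hx)]
    constructor
    · intro h
      exact absurd (KSATRed.encode_decCNF_of_mem h) hx
    · intro h
      exact absurd h singleton_not_mem_cspLanguage

end LPMachine

end Literature.ModelTheory.FiniteModelTheory

end
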